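import Literature.NumberTheory.Automorphic.MirabolicEisensteinResidueBound
import Literature.NumberTheory.Automorphic.RankinSelbergSiegelFiniteness
import Literature.NumberTheory.Automorphic.MirabolicEisensteinContinuity
import Literature.NumberTheory.Automorphic.PairLFunctionPolesRankinSelberg
import HarnessLib

/-!
# The residue of the global Rankin–Selberg integral `∫ φ φ' E(·, Φ; s)` at `s = 1`

Topic `NumberTheory/Automorphic`; namespace `Literature.NumberTheory.Automorphic`. Proof file: theorems
only (no definition, no named fact). Sequel to `MirabolicEisensteinResidue` (the pole
`(s - 1) E(g, Φ; s) → c_D V Φ̂(0) / n` of the mirabolic Eisenstein series, Tate's method) and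
`MirabolicEisensteinResidueBound` (the residual term, uniformly in `g`). Here the pole is integrated
against two rapidly decreasing automorphic functions: for the global Rankin–Selberg integral
`I(s; φ, φ', Φ) = ∫ φ φ' E_X(·, Φ; s) dμ'` over `GL_n(𝔸_K) ⧸ A_G GL_n(K)` (`rankinSelbergIntegral`,
`PairLFunctionPolesRankinSelberg`; Jacquet–Shalika (1981), §4; Cogdell (2004), §2.3, p. 211)

  **`(s - 1) I(s; φ, φ', Φ) ⟶ c_D · V · Φ̂(0) / n · ∫ φ φ' dμ'`  (`s → 1`, `re s > 1`)**

(`tendsto_sub_one_mul_rankinSelbergIntegral`), i.e. Cogdell's "`Res_{s=1} I(s; φ, φ', Φ) = c Φ̂(0) ∫ φ̃ φ̃'`"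
for `η = 1` (with `φ̃(g) = φ(ᵗg⁻¹)` and the invariance of the measure under `g ↦ ᵗg⁻¹` the printed
integral is `∫ φ φ'`), for `Φ` in the Fourier-stable Schwartz–Bruhat class `piSchwartzBruhat K (Fin n)`
and `φ`, `φ'` continuous on the quotient with rapidly decreasing classical functions
(`IsRapidlyDecreasingGL`, Getz–Hahn Def. 9.3; e.g. smoothed `L²` cusp forms,
`isRapidlyDecreasingGL_invQuot_smoothedForm`). This is hypothesis (ii) — the residue `r = c Φ̂(0) ‖φ‖²` of
`(s - 1) I(s)` — of the reduction `JacquetShalika1981_partialPairL_pole_of_eq_conj_of_rankinSelberg` of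
Arthur–Clozel's (2.3) (`PairLFunctionPolesRankinSelberg`).

The proof is a **uniform** `O(‖s - 1‖)` estimate rather than dominated convergence:

* `continuous_tateVectorIntegral_and_tsum_of_decay`, `continuous_mirabolicEisenstein_of_mem_piSchwartzBruhat`,
  `continuous_mirabolicEisensteinQuot_of_mem_piSchwartzBruhat` — continuity of `E(·, Φ; s)` on
  `re s > 1` for decaying `Φ` (the proof of `MirabolicEisensteinContinuity` for standard `Φ`, verbatim on
  its decay data) and for `Φ ∈ piSchwartzBruhat`; this makes `φ φ' E_X` a genuine Bochner integrand;
* `exists_tsum_lintegral_vecMul_mul_le_of_mem_piSchwartzBruhat` — polynomial growth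
  `𝓜(Φ, σ, diag(b) c) ≤ (min bⱼ)^{-n[K:ℚ]σ} C` of the Eisenstein majorant along `A_T · C₁` for
  `Φ ∈ piSchwartzBruhat` (as `exists_tsum_lintegral_vecMul_mul_le` of `MirabolicEisensteinMajorant`);
* `exists_siegel_decomposition` (`g = diag(z(b)) · y` on a Siegel set `Z Ω A_{T₀}(t) K`, `y` in a fixed
  compact set), `exists_norm_le_on_siegelSet` (rapidly decreasing functions are bounded there),
  `glTransposeInv_mul`, `continuous_glTransposeInv`, `glTransposeInv_posRealDiagonal`;
* `setLIntegral_siegel_normSq_mul_majorant_lt_top_of_mem_piSchwartzBruhat`,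
  `setLIntegral_siegel_normSq_mul_dualMajorant_lt_top`, `setLIntegral_siegel_normSq_mul_residualMajorant_lt_top`
  — `∫_𝔖 |φ|² 𝓜(Φ, σ, g) < ∞`, `∫_𝔖 |φ|² 𝓜(Ψ, σ, ᵗg⁻¹) < ∞` (on the cone `bⱼ⁻¹ ≥ ((Tⁿ Rⁿ)⁻¹)ⁿ`,
  `pow_le_inv_of_prod_eq_one`) and the finiteness of the whole residual majorant of
  `norm_sub_one_mul_mirabolicEisenstein_sub_le` against `|φ|²` over a Siegel set (rapid decay beats the
  polynomial growth; `measure_mul_siegelSet_lt_top`);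
* `enorm_sub_one_mul_mirabolicEisenstein_sub_residue_le` — pointwise,
  `‖(s - 1) E(g, Φ; s) - R‖ ≤ ‖s - 1‖ H(g)` for `1 < re s ≤ 2`, `‖s - 1‖ |log|det g|| ≤ 1`, with
  `R = c_D V Φ̂(0) / n` (`norm_sub_one_mul_mirabolicEisenstein_sub_le` and
  `‖|det g|^{s-1} - 1‖ ≤ 2 ‖s - 1‖ |log |det g||`);
* `tendsto_sub_one_mul_rankinSelbergIntegral` — **main**: `‖(s - 1) I(s) - R ∫ φ φ'‖ ≤ ‖s - 1‖ · c · J`,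
  `J = ∫_𝔖 |φ φ'| H dμ_G < ∞`, by the domination of the automorphic measure by a Siegel-set Haar integral
  (`exists_lintegral_le_mul_setLIntegral_siegel`), `|det g|^{±1}` being bounded on `𝔖`.

Measurable structures: Borel on `𝔸_K` (instance arguments), `Units.instMeasurableSpace` on `𝔸_Kˣ`
(Borel, `borelSpace_ideleGroup`, a file-local instance as in `MirabolicEisensteinResidue`), `borel` on
`GL_n(𝔸_K)` inside the proofs.

## References

* H. Jacquet, J. A. Shalika, *On Euler products and the classification of automorphic representations
  I*, Amer. J. Math. 103 (1981), 499–558, §4 [JacquetShalikaAJM1981].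
* J. W. Cogdell, *Analytic theory of L-functions for GL_n*, in J. Bernstein, S. Gelbart (eds.), *An
  Introduction to the Langlands Program* (2004), §2.3, pp. 210–211 [CogdellAnalyticTheory2004].
* R. Godement, H. Jacquet, *Zeta functions of simple algebras*, LNM 260 (1972), §11–12
  [GodementJacquetLNM260].
* J. R. Getz, H. Hahn, *An Introduction to Automorphic Representations* (2024), Def. 9.3, Thm. 2.7.2
  [GetzHahn2024].
-/

noncomputable section

open scoped NNReal ENNReal Topology Classical Pointwise MatrixGroups
open NumberField NumberField.mixedEmbedding IsDedekindDomain MeasureTheory Measure Matrix Filter Set Module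

namespace Literature.NumberTheory.Automorphic

/-! ### More on the transpose-inverse -/

section TransposeInv

variable {n : ℕ} {R : Type*} [CommRing R]

/-- `ᵗ(gh)⁻¹ = ᵗg⁻¹ ᵗh⁻¹`: the transpose-inverse is multiplicative. [folklore] -/
theorem glTransposeInv_mul (g h : GL (Fin n) R) :
    glTransposeInv (g * h) = glTransposeInv g * glTransposeInv h := by
  refine Units.ext ?_
  rw [Units.val_mul, coe_glTransposeInv, coe_glTransposeInv, coe_glTransposeInv, _root_.mul_inv_rev,
    Units.val_mul, Matrix.transpose_mul]

/-- The transpose-inverse is continuous on `GL_n(R)` for a topological ring `R`. [folklore] -/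
theorem continuous_glTransposeInv [TopologicalSpace R] [IsTopologicalRing R] :
    Continuous (glTransposeInv : GL (Fin n) R → GL (Fin n) R) := by
  refine Units.continuous_iff.2 ⟨?_, ?_⟩
  · exact (Units.continuous_coe_inv.matrix_transpose :
      Continuous fun g : GL (Fin n) R => ((g⁻¹ : GL (Fin n) R) : Matrix (Fin n) (Fin n) R)ᵀ)
  · have h : ∀ g : GL (Fin n) R, ((glTransposeInv g)⁻¹ : GL (Fin n) R) =
        ⟨((g : GL (Fin n) R) : Matrix (Fin n) (Fin n) R)ᵀ, ((g⁻¹ : GL (Fin n) R) : Matrix (Fin n) (Fin n) R)ᵀ,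
          by rw [← Matrix.transpose_mul, ← Units.val_mul, inv_mul_cancel, Units.val_one, Matrix.transpose_one],
          by rw [← Matrix.transpose_mul, ← Units.val_mul, mul_inv_cancel, Units.val_one, Matrix.transpose_one]⟩ :=
      fun g => rfl
    simp only [h]
    exact Units.continuous_val.matrix_transpose

end TransposeInv

section TransposeInvDiag

variable (n : ℕ) (K : Type) [Field K] [NumberField K]

/-- `ᵗ(diag z(b))⁻¹ = diag z(b⁻¹)` on the positive real diagonal torus. [folklore] -/
theorem glTransposeInv_posRealDiagonal (b : Fin n → ℝ≥0ˣ) :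
    glTransposeInv (posRealDiagonal n K b) = posRealDiagonal n K b⁻¹ := by
  refine Units.ext ?_
  rw [coe_glTransposeInv, ← map_inv, coe_posRealDiagonal, Matrix.diagonal_transpose]

end TransposeInvDiag

variable (K : Type) [Field K] [NumberField K] {n : ℕ}
variable [MeasurableSpace (AdeleRing (𝓞 K) K)] [BorelSpace (AdeleRing (𝓞 K) K)]

attribute [local instance] borelSpace_ideleGroup

/-! ### Polynomial growth of the majorant for `Φ ∈ piSchwartzBruhat` -/

section Growth

/-- **Polynomial growth of the majorant along `A_T · C₁` for `Φ` in the restricted tensor product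
`piSchwartzBruhat K (Fin n)`** (the Schwartz–Bruhat class stable under the adelic Fourier transform,
`AdelicPiSchwartzBruhatFourier`): for a Haar measure `ν` on `𝔸_Kˣ`, `σ > 1` and a compact
`C₁ ⊆ GL_n(𝔸_K)` there is `C < ∞` with
`∑_p ∫ |Φ(a ξ_p d c)| |a|^{nσ} dν(a) ≤ m^{-n [K:ℚ] σ} · C` for all `c ∈ C₁` and all positive real
diagonal `d = diag(b_j)`, `b_j ≥ m > 0`. Same proof as `exists_tsum_lintegral_vecMul_mul_le`
(`MirabolicEisensteinMajorant`, standard `Φ`), the decay and compact-support input being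
`exists_decay_of_mem_piSchwartzBruhat`. (Godement–Jacquet (1972), §11: moderate growth of the
Eisenstein series in its domain of convergence.) [cite: GodementJacquetLNM260, §11] -/
theorem exists_tsum_lintegral_vecMul_mul_le_of_mem_piSchwartzBruhat
    (ν : Measure (GaloisRepresentations.ideleGroup K)) [ν.IsHaarMeasure]
    {Φ : (Fin n → AdeleRing (𝓞 K) K) → ℂ} (hΦ : Φ ∈ piSchwartzBruhat K (Fin n)) {σ : ℝ} (hσ : 1 < σ)
    {C₁ : Set (GL (Fin n) (AdeleRing (𝓞 K) K))} (hC₁ : IsCompact C₁) :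
    ∃ C : ℝ≥0∞, C ≠ ⊤ ∧ ∀ c ∈ C₁, ∀ (m : ℝ≥0ˣ) (b : Fin n → ℝ≥0ˣ), (∀ j, (m : ℝ≥0) ≤ (b j : ℝ≥0)) →
      ∑' p : Projectivization K (Fin n → K),
        ∫⁻ a, (‖Φ ((a : AdeleRing (𝓞 K) K) • (ratVec K p.rep ᵥ*
            ((posRealDiagonal n K b * c : GL (Fin n) (AdeleRing (𝓞 K) K)) :
              Matrix (Fin n) (Fin n) (AdeleRing (𝓞 K) K))))‖ₑ : ℝ≥0∞) *
          ENNReal.ofReal ((IdeleClassGroup.ideleNorm K a : ℝ) ^ ((n : ℝ) * σ)) ∂ν ≤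
        ENNReal.ofReal ((((m : ℝ≥0) : ℝ) ^ finrank ℚ K) ^ (-((n : ℝ) * σ))) * C := by
  -- decay and support of `Φ` to an order `k > n [K:ℚ] σ`
  set k : ℕ := ⌊(n : ℝ) * finrank ℚ K * σ⌋₊ + 1 with hk'
  have hk : (n : ℝ) * finrank ℚ K * σ < k := by
    rw [hk']
    push_cast
    exact Nat.lt_floor_add_one _
  obtain ⟨M, hM0, Cf, hCfc, hM, hCf⟩ := exists_decay_of_mem_piSchwartzBruhat hΦ k
  obtain ⟨M', Cf', hM'0, hCf'c, hCf'cl, hdom⟩ :=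
    exists_radialMajorant_of_isCompact K hM0 hM hCfc hCf hC₁
  -- the radial majorant `Φ₀`
  set Φ₀ : (Fin n → AdeleRing (𝓞 K) K) → ℂ := fun y =>
    (((M' * (1 + ‖vecInfinitePart K n y‖) ^ (-(k : ℝ)) *
      Cf'.indicator (fun _ => (1 : ℝ)) (vecFinitePart K n y) : ℝ) : ℂ)) with hΦ₀
  have hmeas₀ : ∀ x : Fin n → AdeleRing (𝓞 K) K, Measurable fun a : GaloisRepresentations.ideleGroup K =>
      (‖Φ₀ ((a : AdeleRing (𝓞 K) K) • x)‖ₑ : ℝ≥0∞) :=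
    fun x => measurable_enorm_radialMajorant_smul K M' k hCf'cl x
  have hM₀ : ∀ y, ‖Φ₀ y‖ ≤ M' * (1 + ‖vecInfinitePart K n y‖) ^ (-(k : ℝ)) :=
    fun y => norm_radialMajorant_le hM'0 k Cf' y
  have hCf₀ : ∀ y, vecFinitePart K n y ∉ Cf' → Φ₀ y = 0 := fun y hy => radialMajorant_eq_zero M' k hy
  have hrad₀ : ∀ x y, ‖vecInfinitePart K n x‖ ≤ ‖vecInfinitePart K n y‖ →
      vecFinitePart K n x = vecFinitePart K n y → ‖Φ₀ y‖ ≤ ‖Φ₀ x‖ :=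
    fun x y hxy hf => norm_radialMajorant_le_of_le hM'0 k Cf' hxy hf
  have hfin := tsum_lintegral_enorm_smul_lt_top_of_decay K ν
    (1 : GL (Fin n) (AdeleRing (𝓞 K) K)) hmeas₀ hM'0 hM₀ hCf'c hCf₀ hσ hk
  simp only [Matrix.GeneralLinearGroup.coe_one, Matrix.vecMul_one] at hfin
  refine ⟨_, hfin.ne, fun c hc m b hb => ?_⟩
  calc ∑' p : Projectivization K (Fin n → K),
        ∫⁻ a, (‖Φ ((a : AdeleRing (𝓞 K) K) • (ratVec K p.rep ᵥ*
            ((posRealDiagonal n K b * c : GL (Fin n) (AdeleRing (𝓞 K) K)) :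
              Matrix (Fin n) (Fin n) (AdeleRing (𝓞 K) K))))‖ₑ : ℝ≥0∞) *
          ENNReal.ofReal ((IdeleClassGroup.ideleNorm K a : ℝ) ^ ((n : ℝ) * σ)) ∂ν
      ≤ ∑' p : Projectivization K (Fin n → K),
        ∫⁻ a, (‖Φ₀ ((a : AdeleRing (𝓞 K) K) • (ratVec K p.rep ᵥ*
            (posRealDiagonal n K b : Matrix (Fin n) (Fin n) (AdeleRing (𝓞 K) K))))‖ₑ : ℝ≥0∞) *
          ENNReal.ofReal ((IdeleClassGroup.ideleNorm K a : ℝ) ^ ((n : ℝ) * σ)) ∂ν := by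
        refine ENNReal.tsum_le_tsum fun p => lintegral_mono fun a => mul_le_mul' ?_ le_rfl
        rw [← ofReal_norm, ← ofReal_norm]
        refine ENNReal.ofReal_le_ofReal ?_
        rw [Matrix.GeneralLinearGroup.coe_mul, ← Matrix.vecMul_vecMul, ← Matrix.smul_vecMul]
        exact hdom c hc _
    _ ≤ ∑' p : Projectivization K (Fin n → K),
        ENNReal.ofReal ((((m : ℝ≥0) : ℝ) ^ finrank ℚ K) ^ (-((n : ℝ) * σ))) *
          ∫⁻ a, (‖Φ₀ ((a : AdeleRing (𝓞 K) K) • ratVec K p.rep)‖ₑ : ℝ≥0∞) *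
            ENNReal.ofReal ((IdeleClassGroup.ideleNorm K a : ℝ) ^ ((n : ℝ) * σ)) ∂ν :=
        ENNReal.tsum_le_tsum fun p => lintegral_vecMul_posRealDiagonal_le K ν hrad₀ hb _ _
    _ = ENNReal.ofReal ((((m : ℝ≥0) : ℝ) ^ finrank ℚ K) ^ (-((n : ℝ) * σ))) *
        ∑' p : Projectivization K (Fin n → K),
          ∫⁻ a, (‖Φ₀ ((a : AdeleRing (𝓞 K) K) • ratVec K p.rep)‖ₑ : ℝ≥0∞) *
            ENNReal.ofReal ((IdeleClassGroup.ideleNorm K a : ℝ) ^ ((n : ℝ) * σ)) ∂ν :=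
        ENNReal.tsum_mul_left

end Growth

/-! ### Continuity of `g ↦ E(g, Φ; s)` on `re s > 1` for decaying `Φ` and for `Φ ∈ piSchwartzBruhat` -/

section Continuity

/-- **Continuity of the Tate-type integrals `g ↦ ∫ Φ(a ξ g) |a|^{ns} dν(a)` and of their sum over
`ξ ∈ ℙ^{n-1}(K)`, for a general decaying `Φ`.** If `Φ` is continuous, `|Φ(x)| ≤ M (1 + ‖x_∞‖)^{-k}`,
`Φ(x) = 0` unless `x_f` lies in a compact set, `re s > 1` and `k > n [K:ℚ] re s`, then each Tate-type
integral and their sum are continuous on `GL_n(𝔸_K)`. This is the proof of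
`continuous_tateVectorIntegral_and_tsum_of_isStandard` (`MirabolicEisensteinContinuity`) verbatim, which
only used these decay data of a standard Schwartz–Bruhat function: local domination of the translates
`Φ(· g)` by one radial majorant (`exists_radialMajorant_of_isCompact`), dominated convergence and the
`M`-test. [cite: GodementJacquetLNM260, §11] -/
theorem continuous_tateVectorIntegral_and_tsum_of_decay
    (ν : Measure (GaloisRepresentations.ideleGroup K)) [ν.IsHaarMeasure]
    {Φ : (Fin n → AdeleRing (𝓞 K) K) → ℂ} (hΦc : Continuous Φ) {k : ℕ} {M : ℝ} (hM0 : 0 ≤ M)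
    (hM : ∀ x, ‖Φ x‖ ≤ M * (1 + ‖vecInfinitePart K n x‖) ^ (-(k : ℝ)))
    {Cf : Set (Fin n → FiniteAdeleRing (𝓞 K) K)} (hCfc : IsCompact Cf)
    (hCf : ∀ x, vecFinitePart K n x ∉ Cf → Φ x = 0) {s : ℂ} (hs : 1 < s.re)
    (hk : (n : ℝ) * finrank ℚ K * s.re < k) :
    (∀ p : Projectivization K (Fin n → K), Continuous fun g : GL (Fin n) (AdeleRing (𝓞 K) K) =>
      tateVectorIntegral K ν Φ s (ratVec K p.rep ᵥ* (g : Matrix (Fin n) (Fin n) (AdeleRing (𝓞 K) K)))) ∧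
    Continuous fun g : GL (Fin n) (AdeleRing (𝓞 K) K) => ∑' p : Projectivization K (Fin n → K),
      tateVectorIntegral K ν Φ s (ratVec K p.rep ᵥ* (g : Matrix (Fin n) (Fin n) (AdeleRing (𝓞 K) K))) := by
  haveI : LocallyCompactSpace (GL (Fin n) (AdeleRing (𝓞 K) K)) :=
    AdelicGroupData.locallyCompactSpace_generalLinearGroup_adeleRing K (Fin n)
  haveI : SecondCountableTopology (GL (Fin n) (AdeleRing (𝓞 K) K)) :=
    secondCountableTopology_generalLinearGroup_adeleRing K (Fin n)
  set σ : ℝ := s.re with hσ'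
  have hσ : 1 < σ := hs
  -- the kernel and its continuity / measurability
  set kern : Projectivization K (Fin n → K) → GL (Fin n) (AdeleRing (𝓞 K) K) →
      GaloisRepresentations.ideleGroup K → ℂ := fun p g =>
    eisensteinKernel K Φ s (ratVec K p.rep ᵥ* (g : Matrix (Fin n) (Fin n) (AdeleRing (𝓞 K) K))) with hkern
  have hkern_meas : ∀ p g, AEStronglyMeasurable (kern p g) ν := fun p g =>
    (continuous_eisensteinKernel K hΦc s _).aestronglyMeasurable
  have hkern_cont : ∀ p a, Continuous fun g : GL (Fin n) (AdeleRing (𝓞 K) K) => kern p g a := by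
    intro p a
    simp only [hkern, eisensteinKernel]
    exact (hΦc.comp ((continuous_const (y := (a : AdeleRing (𝓞 K) K))).smul
      (continuous_ratVec_vecMul K p.rep))).mul continuous_const
  -- local domination near a point `g₀`
  have hloc : ∀ g₀ : GL (Fin n) (AdeleRing (𝓞 K) K), ∃ C₁ ∈ 𝓝 g₀,
      ∃ (bound : Projectivization K (Fin n → K) → GaloisRepresentations.ideleGroup K → ℝ)
        (u : Projectivization K (Fin n → K) → ℝ),
        (∀ p, Integrable (bound p) ν) ∧ Summable u ∧
        (∀ p, ∀ g ∈ C₁, ∀ a, ‖kern p g a‖ ≤ bound p a) ∧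
        (∀ p, ∫ a, bound p a ∂ν ≤ u p) := by
    intro g₀
    obtain ⟨C₁, hC₁c, hC₁n⟩ := exists_compact_mem_nhds g₀
    obtain ⟨M', Cf', hM'0, hCf'c, hCf'cl, hdom⟩ :=
      exists_radialMajorant_of_isCompact K hM0 hM hCfc hCf hC₁c
    -- the radial majorant `Φ₀` and its finite majorant series
    set Φ₀ : (Fin n → AdeleRing (𝓞 K) K) → ℂ := fun y =>
      (((M' * (1 + ‖vecInfinitePart K n y‖) ^ (-(k : ℝ)) *
        Cf'.indicator (fun _ => (1 : ℝ)) (vecFinitePart K n y) : ℝ) : ℂ)) with hΦ₀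
    have hmeas₀ : ∀ x : Fin n → AdeleRing (𝓞 K) K, Measurable fun a : GaloisRepresentations.ideleGroup K =>
        (‖Φ₀ ((a : AdeleRing (𝓞 K) K) • x)‖ₑ : ℝ≥0∞) :=
      fun x => measurable_enorm_radialMajorant_smul K M' k hCf'cl x
    have hM₀ : ∀ y, ‖Φ₀ y‖ ≤ M' * (1 + ‖vecInfinitePart K n y‖) ^ (-(k : ℝ)) :=
      fun y => norm_radialMajorant_le hM'0 k Cf' y
    have hCf₀ : ∀ y, vecFinitePart K n y ∉ Cf' → Φ₀ y = 0 := fun y hy => radialMajorant_eq_zero M' k hy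
    have hfin := tsum_lintegral_enorm_smul_lt_top_of_decay K ν
      (1 : GL (Fin n) (AdeleRing (𝓞 K) K)) hmeas₀ hM'0 hM₀ hCf'c hCf₀ hσ hk
    simp only [Matrix.GeneralLinearGroup.coe_one, Matrix.vecMul_one] at hfin
    set U : Projectivization K (Fin n → K) → ℝ≥0∞ := fun p =>
      ∫⁻ a, (‖Φ₀ ((a : AdeleRing (𝓞 K) K) • ratVec K p.rep)‖ₑ : ℝ≥0∞) *
        ENNReal.ofReal ((IdeleClassGroup.ideleNorm K a : ℝ) ^ ((n : ℝ) * σ)) ∂ν with hU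
    have hUfin : ∀ p, U p < ⊤ := fun p => lt_of_le_of_lt (ENNReal.le_tsum p) hfin
    -- the dominating functions
    set bound : Projectivization K (Fin n → K) → GaloisRepresentations.ideleGroup K → ℝ := fun p a =>
      ‖Φ₀ ((a : AdeleRing (𝓞 K) K) • ratVec K p.rep)‖ *
        (IdeleClassGroup.ideleNorm K a : ℝ) ^ ((n : ℝ) * σ) with hbound
    have hbound_nn : ∀ p a, 0 ≤ bound p a := fun p a =>
      mul_nonneg (norm_nonneg _) (Real.rpow_nonneg (NNReal.coe_nonneg _) _)
    have hbound_enorm : ∀ p a, (‖bound p a‖ₑ : ℝ≥0∞) =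
        (‖Φ₀ ((a : AdeleRing (𝓞 K) K) • ratVec K p.rep)‖ₑ : ℝ≥0∞) *
          ENNReal.ofReal ((IdeleClassGroup.ideleNorm K a : ℝ) ^ ((n : ℝ) * σ)) := by
      intro p a
      rw [Real.enorm_eq_ofReal (hbound_nn p a), hbound, ENNReal.ofReal_mul (norm_nonneg _), ofReal_norm]
    have hc : Continuous fun a : GaloisRepresentations.ideleGroup K =>
        (IdeleClassGroup.ideleNorm K a : ℝ) ^ ((n : ℝ) * σ) :=
      (NNReal.continuous_coe.comp (continuous_ideleNorm_holds K)).rpow_const fun a =>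
        Or.inl (NNReal.coe_ne_zero.2 (ideleNorm_ne_zero a))
    have hbound_meas : ∀ p, AEStronglyMeasurable (bound p) ν := by
      intro p
      have h1 : Measurable fun a : GaloisRepresentations.ideleGroup K =>
          ‖Φ₀ ((a : AdeleRing (𝓞 K) K) • ratVec K p.rep)‖ := by
        simpa only [toReal_enorm] using (hmeas₀ (ratVec K p.rep)).ennreal_toReal
      exact (h1.mul hc.measurable).aestronglyMeasurable
    have hbound_int : ∀ p, Integrable (bound p) ν := fun p =>
      ⟨hbound_meas p, by
        change ∫⁻ a, ‖bound p a‖ₑ ∂ν < ⊤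
        simp_rw [hbound_enorm]
        exact hUfin p⟩
    have hbound_integral : ∀ p, ∫ a, bound p a ∂ν = (U p).toReal := by
      intro p
      rw [integral_eq_lintegral_of_nonneg_ae (Eventually.of_forall (hbound_nn p)) (hbound_meas p)]
      congr 1
      refine lintegral_congr fun a => ?_
      rw [← Real.enorm_eq_ofReal (hbound_nn p a), hbound_enorm]
    -- domination of the kernels on `C₁`
    have hdom' : ∀ p, ∀ g ∈ C₁, ∀ a, ‖kern p g a‖ ≤ bound p a := by
      intro p g hg a
      simp only [hkern, hbound]
      rw [norm_eisensteinKernel, ← Matrix.smul_vecMul]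
      exact mul_le_mul_of_nonneg_right (hdom g hg _) (Real.rpow_nonneg (NNReal.coe_nonneg _) _)
    refine ⟨C₁, hC₁n, bound, fun p => (U p).toReal, hbound_int, ENNReal.summable_toReal hfin.ne,
      hdom', fun p => (hbound_integral p).le⟩
  -- (i) each Tate-type integral is continuous
  have hT : ∀ p : Projectivization K (Fin n → K), Continuous fun g : GL (Fin n) (AdeleRing (𝓞 K) K) =>
      tateVectorIntegral K ν Φ s (ratVec K p.rep ᵥ* (g : Matrix (Fin n) (Fin n) (AdeleRing (𝓞 K) K))) := by
    intro p
    refine continuous_iff_continuousAt.2 fun g₀ => ?_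
    obtain ⟨C₁, hC₁n, bound, u, hbi, -, hdom', -⟩ := hloc g₀
    change ContinuousAt (fun g => ∫ a, kern p g a ∂ν) g₀
    exact continuousAt_of_dominated (Eventually.of_forall (hkern_meas p))
      (Filter.eventually_of_mem hC₁n fun g hg => Eventually.of_forall (hdom' p g hg)) (hbi p)
      (Eventually.of_forall fun a => (hkern_cont p a).continuousAt)
  refine ⟨hT, ?_⟩
  -- (ii) the sum is continuous: `M`-test on a neighbourhood of each point
  refine continuous_iff_continuousAt.2 fun g₀ => ?_
  obtain ⟨C₁, hC₁n, bound, u, hbi, hu, hdom', hint⟩ := hloc g₀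
  have hOn : ContinuousOn (fun g : GL (Fin n) (AdeleRing (𝓞 K) K) => ∑' p : Projectivization K (Fin n → K),
      tateVectorIntegral K ν Φ s (ratVec K p.rep ᵥ* (g : Matrix (Fin n) (Fin n) (AdeleRing (𝓞 K) K)))) C₁ := by
    refine continuousOn_tsum (fun p => (hT p).continuousOn) hu fun p g hg => ?_
    change ‖∫ a, kern p g a ∂ν‖ ≤ u p
    calc ‖∫ a, kern p g a ∂ν‖ ≤ ∫ a, ‖kern p g a‖ ∂ν := norm_integral_le_integral_norm _
      _ ≤ ∫ a, bound p a ∂ν :=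
          integral_mono_of_nonneg (Eventually.of_forall fun a => norm_nonneg _) (hbi p)
            (Eventually.of_forall (hdom' p g hg))
      _ ≤ u p := hint p
  exact hOn.continuousAt hC₁n

/-! ### All of `𝒮(𝔸_Kⁿ)`: linearity -/


/-- **`g ↦ E(g, Φ; s)` is continuous on `GL_n(𝔸_K)` for `Φ ∈ piSchwartzBruhat K (Fin n)`** and
`re s > 1` (decay to every order, `exists_decay_of_mem_piSchwartzBruhat`, and
`continuous_tateVectorIntegral_and_tsum_of_decay`). [cite: JacquetShalikaAJM1981, §4] -/
theorem continuous_mirabolicEisenstein_of_mem_piSchwartzBruhat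
    (ν : Measure (GaloisRepresentations.ideleGroup K)) [ν.IsHaarMeasure]
    {Φ : (Fin n → AdeleRing (𝓞 K) K) → ℂ} (hΦ : Φ ∈ piSchwartzBruhat K (Fin n)) {s : ℂ} (hs : 1 < s.re) :
    Continuous (mirabolicEisenstein K ν Φ s) := by
  set k : ℕ := ⌊(n : ℝ) * finrank ℚ K * s.re⌋₊ + 1 with hk'
  have hk : (n : ℝ) * finrank ℚ K * s.re < k := by
    rw [hk']
    push_cast
    exact Nat.lt_floor_add_one _
  obtain ⟨M, hM0, Cf, hCfc, hM, hCf⟩ := exists_decay_of_mem_piSchwartzBruhat hΦ k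
  have hdet : Continuous fun g : GL (Fin n) (AdeleRing (𝓞 K) K) =>
      (((IdeleClassGroup.ideleNorm K (Matrix.GeneralLinearGroup.det g) : ℝ) : ℂ)) ^ s := by
    refine Continuous.cpow ?_ continuous_const fun g => Complex.ofReal_mem_slitPlane.2
      (NNReal.coe_pos.2 (pos_iff_ne_zero.2 (ideleNorm_ne_zero _)))
    exact Complex.continuous_ofReal.comp (NNReal.continuous_coe.comp
      ((continuous_ideleNorm_holds K).comp Matrix.GeneralLinearGroup.continuous_det))
  exact hdet.mul (continuous_tateVectorIntegral_and_tsum_of_decay K ν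
    (continuous_of_mem_piSchwartzBruhat hΦ) hM0 hM hCfc hCf hs hk).2

/-- **The descended Eisenstein series `E_X` is continuous on `GL_n(𝔸_K) ⧸ A_G GL_n(K)`** for
`Φ ∈ piSchwartzBruhat K (Fin n)` and `re s > 1`; in particular it is Borel measurable there, which is what
makes the Rankin–Selberg integrand `φ φ' E_X` a genuine Bochner integrand. [folklore] -/
theorem continuous_mirabolicEisensteinQuot_of_mem_piSchwartzBruhat
    (ν : Measure (GaloisRepresentations.ideleGroup K)) [ν.IsHaarMeasure] [ν.IsMulRightInvariant]
    {Φ : (Fin n → AdeleRing (𝓞 K) K) → ℂ} (hΦ : Φ ∈ piSchwartzBruhat K (Fin n)) {s : ℂ} (hs : 1 < s.re) :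
    Continuous (mirabolicEisensteinQuot (K := K) ν Φ s) := by
  have h : Continuous fun x : GL (Fin n) (AdeleRing (𝓞 K) K) =>
      mirabolicEisenstein K ν Φ s (x⁻¹ : GL (Fin n) (AdeleRing (𝓞 K) K)) :=
    (continuous_mirabolicEisenstein_of_mem_piSchwartzBruhat K ν hΦ hs).comp continuous_inv
  exact h.quotient_lift _

end Continuity

/-! ### Siegel sets: the decomposition `g = diag(z(b)) · y` and finiteness of the majorants -/

section Siegel

variable {K}

omit [MeasurableSpace (AdeleRing (𝓞 K) K)] [BorelSpace (AdeleRing (𝓞 K) K)] in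
/-- **The decomposition `g = a · y` on a Siegel set.** For Siegel data `Ω ⊆ B(𝔸_K)` compact, `t > 0`,
`Z ⊆ A_G` there is a compact `C` such that every `g ∈ Z · Ω · A_{T₀}(t) · K` is `g = diag(z(b)) · y`
with `b` a cone vector (`∏ bᵢ = 1`, `t bᵢ₊₁ ≤ bᵢ`) and `y ∈ Z · C · K`: writing `g = z ω a k`,
`g = a · (z (a⁻¹ ω a) k)` with `a⁻¹ ω a` in the compact set of
`exists_isCompact_conj_siegelCone_mem_of_subset`. [folklore] -/
theorem exists_siegel_decomposition {Ω : Set (GL (Fin n) (AdeleRing (𝓞 K) K))} (hΩc : IsCompact Ω)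
    (hΩB : Ω ⊆ (standardParabolicGL (AdeleRing (𝓞 K) K) (id : Fin n → Fin n) :
      Set (GL (Fin n) (AdeleRing (𝓞 K) K))))
    {t : ℝ} (ht : 0 < t) {Z : Set (GL (Fin n) (AdeleRing (𝓞 K) K))} (hZ : Z ⊆ Set.range (posRealScalar n K)) :
    ∃ C : Set (GL (Fin n) (AdeleRing (𝓞 K) K)), IsCompact C ∧
      ∀ g ∈ Z * (Ω * siegelCone n K t *
          (standardMaximalCompactGL n K : Set (GL (Fin n) (AdeleRing (𝓞 K) K)))),
        ∃ b : Fin n → ℝ≥0ˣ, (∏ i, ((b i : ℝ≥0) : ℝ)) = 1 ∧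
          (∀ i j : Fin n, (j : ℕ) = (i : ℕ) + 1 → t * ((b j : ℝ≥0) : ℝ) ≤ ((b i : ℝ≥0) : ℝ)) ∧
          ∃ y ∈ Z * C * (standardMaximalCompactGL n K : Set (GL (Fin n) (AdeleRing (𝓞 K) K))),
            g = posRealDiagonal n K b * y := by
  obtain ⟨C, hCc, hconj⟩ := exists_isCompact_conj_siegelCone_mem_of_subset ht hΩB hΩc
  refine ⟨C, hCc, fun g hg => ?_⟩
  obtain ⟨z, hz, _, ⟨_, ⟨ω, hω, a, ha, rfl⟩, k, hk, rfl⟩, rfl⟩ := hg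
  obtain ⟨r, hr⟩ := hZ hz
  obtain ⟨b, hprod, hroot, rfl⟩ := ha
  set a : GL (Fin n) (AdeleRing (𝓞 K) K) := posRealDiagonal n K b with ha'
  have hacone : a ∈ siegelCone n K t := ⟨b, hprod, hroot, rfl⟩
  refine ⟨b, hprod, hroot, z * (a⁻¹ * ω * a) * k, ⟨_, ⟨_, hz, _, hconj a hacone ω hω, rfl⟩, k, hk, rfl⟩, ?_⟩
  have hzc : ∀ g : GL (Fin n) (AdeleRing (𝓞 K) K), g * z = z * g := fun g => by
    rw [← hr]
    exact Subgroup.mem_center_iff.1 (posRealScalar_mem_center n K r) g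
  calc z * (ω * a * k)
      = (a * a⁻¹) * z * ω * a * k := by rw [mul_inv_cancel, one_mul]; simp only [mul_assoc]
    _ = a * (z * (a⁻¹ * ω * a) * k) := by
        rw [mul_assoc a a⁻¹, hzc a⁻¹]
        simp only [mul_assoc]

omit [MeasurableSpace (AdeleRing (𝓞 K) K)] [BorelSpace (AdeleRing (𝓞 K) K)] in
/-- **A continuous rapidly decreasing function is bounded on a Siegel set.** [folklore] -/
theorem exists_norm_le_on_siegelSet {φ : (AdelicGroupData.gl n K).Adelic → ℂ} (hφc : Continuous φ)
    (hφ : IsRapidlyDecreasingGL n K φ) {Ω : Set (GL (Fin n) (AdeleRing (𝓞 K) K))} (hΩc : IsCompact Ω)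
    (hΩB : Ω ⊆ (standardParabolicGL (AdeleRing (𝓞 K) K) (id : Fin n → Fin n) :
      Set (GL (Fin n) (AdeleRing (𝓞 K) K))))
    {t : ℝ} (ht : 0 < t) {Z : Set (GL (Fin n) (AdeleRing (𝓞 K) K))} (hZc : IsCompact Z)
    (hZ : Z ⊆ Set.range (posRealScalar n K)) :
    ∃ Cφ : ℝ, 0 ≤ Cφ ∧ ∀ g ∈ Z * (Ω * siegelCone n K t *
        (standardMaximalCompactGL n K : Set (GL (Fin n) (AdeleRing (𝓞 K) K)))), ‖φ g‖ ≤ Cφ := by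
  haveI : T2Space (GL (Fin n) (AdeleRing (𝓞 K) K)) := t2Space_gl n K
  obtain ⟨C, hCc, hdec⟩ := exists_siegel_decomposition hΩc hΩB ht hZ
  have hYc : IsCompact (Z * C * (standardMaximalCompactGL n K : Set (GL (Fin n) (AdeleRing (𝓞 K) K)))) :=
    (hZc.mul hCc).mul (isCompact_standardMaximalCompactGL n K)
  obtain ⟨Cφ, hCφ0, hφb⟩ := exists_uniform_rapidDecay n K hφc hφ hYc ht one_pos
  refine ⟨Cφ, hCφ0, fun g hg => ?_⟩
  obtain ⟨b, hprod, hroot, y, hy, rfl⟩ := hdec g hg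
  obtain ⟨R, hR1, -, hle⟩ := hφb b hprod hroot y hy
  calc ‖φ (posRealDiagonal n K b * y)‖ ≤ Cφ * R ^ (-(1 : ℝ)) := hle
    _ ≤ Cφ * 1 := mul_le_mul_of_nonneg_left
        (Real.rpow_le_one_of_one_le_of_nonpos hR1 (by norm_num)) hCφ0
    _ = Cφ := mul_one _

variable (K)

/-- **The Rankin–Selberg majorant is integrable over a Siegel set, for `Φ ∈ piSchwartzBruhat`.** For
Haar measures `μ_G` on `GL_n(𝔸_K)` and `ν` on `𝔸_Kˣ`, `Φ ∈ piSchwartzBruhat K (Fin n)`, `σ > 1`, a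
continuous rapidly decreasing `φ` and Siegel data as above:
`∫_{Z Ω A_{T₀}(t) K} |φ(g)|² 𝓜(Φ, σ, g) dμ_G(g) < ∞`, `𝓜(Φ, σ, g) = ∑_p ∫ |Φ(a ξ_p g)| |a|^{nσ} dν(a)`.
The variant of `setLIntegral_siegel_normSq_mul_majorant_lt_top` (`RankinSelbergSiegelFiniteness`, stated
for Bump's class `adelicSchwartzBruhat` and with the bounded extra factor `|det g|^σ`) for the
Fourier-stable class; same proof (`exists_tsum_lintegral_vecMul_mul_le_of_mem_piSchwartzBruhat`,
`inv_le_of_siegelCone`, `cone_bookkeeping`, `measure_mul_siegelSet_lt_top`).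
[cite: CogdellAnalyticTheory2004, §2.3, p. 211] -/
theorem setLIntegral_siegel_normSq_mul_majorant_lt_top_of_mem_piSchwartzBruhat
    [MeasurableSpace (GL (Fin n) (AdeleRing (𝓞 K) K))] [BorelSpace (GL (Fin n) (AdeleRing (𝓞 K) K))]
    (μG : Measure (GL (Fin n) (AdeleRing (𝓞 K) K))) [μG.IsHaarMeasure]
    (ν : Measure (GaloisRepresentations.ideleGroup K)) [ν.IsHaarMeasure]
    {Φ : (Fin n → AdeleRing (𝓞 K) K) → ℂ} (hΦ : Φ ∈ piSchwartzBruhat K (Fin n)) {σ : ℝ} (hσ : 1 < σ)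
    {φ : (AdelicGroupData.gl n K).Adelic → ℂ} (hφc : Continuous φ) (hφ : IsRapidlyDecreasingGL n K φ)
    {Ω : Set (GL (Fin n) (AdeleRing (𝓞 K) K))} (hΩc : IsCompact Ω)
    (hΩB : Ω ⊆ (standardParabolicGL (AdeleRing (𝓞 K) K) (id : Fin n → Fin n) :
      Set (GL (Fin n) (AdeleRing (𝓞 K) K))))
    {t : ℝ} (ht : 0 < t) {Z : Set (GL (Fin n) (AdeleRing (𝓞 K) K))} (hZc : IsCompact Z)
    (hZ : Z ⊆ Set.range (posRealScalar n K)) :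
    ∫⁻ g in Z * (Ω * siegelCone n K t *
        (standardMaximalCompactGL n K : Set (GL (Fin n) (AdeleRing (𝓞 K) K)))),
      (‖φ g‖ₑ : ℝ≥0∞) ^ 2 *
        ∑' p : Projectivization K (Fin n → K),
          ∫⁻ a, (‖Φ ((a : AdeleRing (𝓞 K) K) •
              (ratVec K p.rep ᵥ* (g : Matrix (Fin n) (Fin n) (AdeleRing (𝓞 K) K))))‖ₑ : ℝ≥0∞) *
            ENNReal.ofReal ((IdeleClassGroup.ideleNorm K a : ℝ) ^ ((n : ℝ) * σ)) ∂ν ∂μG < ⊤ := by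
  have hmeq := ‹BorelSpace (GL (Fin n) (AdeleRing (𝓞 K) K))›.measurable_eq
  subst hmeq
  letI : MeasurableSpace (GL (Fin n) (AdeleRing (𝓞 K) K)) := borel _
  haveI : T2Space (GL (Fin n) (AdeleRing (𝓞 K) K)) := t2Space_gl n K
  have hKc : IsCompact (standardMaximalCompactGL n K : Set (GL (Fin n) (AdeleRing (𝓞 K) K))) :=
    isCompact_standardMaximalCompactGL n K
  set S : Set (GL (Fin n) (AdeleRing (𝓞 K) K)) := Z * (Ω * siegelCone n K t *
    (standardMaximalCompactGL n K : Set (GL (Fin n) (AdeleRing (𝓞 K) K)))) with hS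
  have hSm : MeasurableSet S := measurableSet_mul_siegelSet n K hZc hΩc ht
  have hSfin : μG S < ⊤ := measure_mul_siegelSet_lt_top μG hΩc hΩB ht hZc hZ
  set F : GL (Fin n) (AdeleRing (𝓞 K) K) → ℝ≥0∞ := fun g =>
    (‖φ g‖ₑ : ℝ≥0∞) ^ 2 *
      ∑' p : Projectivization K (Fin n → K),
        ∫⁻ a, (‖Φ ((a : AdeleRing (𝓞 K) K) •
            (ratVec K p.rep ᵥ* (g : Matrix (Fin n) (Fin n) (AdeleRing (𝓞 K) K))))‖ₑ : ℝ≥0∞) *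
          ENNReal.ofReal ((IdeleClassGroup.ideleNorm K a : ℝ) ^ ((n : ℝ) * σ)) ∂ν with hF
  suffices hbd : ∃ Cst : ℝ≥0∞, Cst ≠ ⊤ ∧ ∀ g ∈ S, F g ≤ Cst by
    obtain ⟨Cst, hCst, hle⟩ := hbd
    calc ∫⁻ g in S, F g ∂μG ≤ ∫⁻ _g in S, Cst ∂μG := setLIntegral_mono' hSm fun g hg => hle g hg
      _ = Cst * μG S := setLIntegral_const _ _
      _ < ⊤ := ENNReal.mul_lt_top hCst.lt_top hSfin
  rcases Nat.eq_zero_or_pos n with hn0 | hn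
  · subst hn0
    haveI : IsEmpty (Projectivization K (Fin 0 → K)) :=
      ⟨fun p => p.rep_nonzero (Subsingleton.elim _ _)⟩
    refine ⟨0, ENNReal.zero_ne_top, fun g _ => ?_⟩
    simp only [hF, tsum_empty, mul_zero, le_refl]
  obtain ⟨CΩ, hCΩc, hdec⟩ := exists_siegel_decomposition hΩc hΩB ht hZ
  set Y : Set (GL (Fin n) (AdeleRing (𝓞 K) K)) := Z * CΩ *
    (standardMaximalCompactGL n K : Set (GL (Fin n) (AdeleRing (𝓞 K) K))) with hY
  have hYc : IsCompact Y := (hZc.mul hCΩc).mul hKc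
  obtain ⟨CM, hCM, hM⟩ := exists_tsum_lintegral_vecMul_mul_le_of_mem_piSchwartzBruhat K ν hΦ hσ hYc
  set B : ℝ := (n : ℝ) * finrank ℚ K * ((n : ℝ) * σ) / 2 with hB
  have hB0 : 0 < B := by
    have : (0 : ℝ) < finrank ℚ K := Nat.cast_pos.2 Module.finrank_pos
    have hn' : (0 : ℝ) < n := Nat.cast_pos.2 hn
    rw [hB]; positivity
  obtain ⟨Cφ, hCφ0, hφb⟩ := exists_uniform_rapidDecay n K hφc hφ hYc ht hB0
  set T : ℝ := max 1 t⁻¹ with hT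
  have hT0 : 0 < T := lt_max_of_lt_left one_pos
  refine ⟨ENNReal.ofReal (Cφ ^ 2 * T ^ ((n : ℝ) * finrank ℚ K * ((n : ℝ) * σ))) * CM,
    ENNReal.mul_ne_top ENNReal.ofReal_ne_top hCM, fun g hg => ?_⟩
  obtain ⟨b, hprod, hroot, y, hyY, rfl⟩ := hdec g hg
  obtain ⟨R, hR1, hRroot, hφay⟩ := hφb b hprod hroot y hyY
  have hR0 : 0 < R := one_pos.trans_le hR1
  set m₀ : ℝ := (T ^ n * R ^ n)⁻¹ with hm₀
  have hm₀pos : 0 < m₀ := inv_pos.2 (mul_pos (pow_pos hT0 n) (pow_pos hR0 n))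
  have hm₀le : ∀ j, m₀ ≤ ((b j : ℝ≥0) : ℝ) := fun j =>
    inv_le_of_siegelCone ht hn hprod hroot hR1 hRroot j
  set m : ℝ≥0ˣ := Units.mk0 ⟨m₀, hm₀pos.le⟩ (by rw [Ne, ← NNReal.coe_eq_zero]; exact hm₀pos.ne')
    with hm
  have hmb : ∀ j, (m : ℝ≥0) ≤ (b j : ℝ≥0) := fun j => NNReal.coe_le_coe.1 (hm₀le j)
  have hMay := hM y hyY m b hmb
  have hφ' : (‖φ (posRealDiagonal n K b * y)‖ₑ : ℝ≥0∞) ^ 2 ≤ ENNReal.ofReal ((Cφ * R ^ (-B)) ^ 2) := by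
    rw [← ofReal_norm, ← ENNReal.ofReal_pow (norm_nonneg _)]
    exact ENNReal.ofReal_le_ofReal (pow_le_pow_left₀ (norm_nonneg _) hφay 2)
  have hbook := cone_bookkeeping (C := Cφ) (e := (n : ℝ) * σ) hT0 hR0 n (finrank ℚ K)
  calc F (posRealDiagonal n K b * y)
      ≤ ENNReal.ofReal ((Cφ * R ^ (-B)) ^ 2) *
          (ENNReal.ofReal ((((m : ℝ≥0) : ℝ) ^ finrank ℚ K) ^ (-((n : ℝ) * σ))) * CM) := by
        simp only [hF]
        exact mul_le_mul' hφ' hMay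
    _ = ENNReal.ofReal ((Cφ * R ^ (-B)) ^ 2 * ((((m : ℝ≥0) : ℝ) ^ finrank ℚ K) ^ (-((n : ℝ) * σ)))) * CM := by
        rw [ENNReal.ofReal_mul (sq_nonneg _), mul_assoc]
    _ = ENNReal.ofReal (Cφ ^ 2 * T ^ ((n : ℝ) * finrank ℚ K * ((n : ℝ) * σ))) * CM := by
        have hmval : ((m : ℝ≥0) : ℝ) = (T ^ n * R ^ n)⁻¹ := rfl
        rw [hmval, hB, hbook]

end Siegel

/-! ### Siegel-set finiteness of the dual majorant `𝓜(Ψ, σ, ᵗg⁻¹)` -/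

section DualFiniteness

/-- Exponent bookkeeping: `R^{-(n B)} = (Rⁿ)^{-B}`. [folklore] -/
theorem rpow_neg_natCast_mul {R : ℝ} (hR : 0 ≤ R) (n : ℕ) (B : ℝ) :
    R ^ (-((n : ℝ) * B)) = (R ^ n) ^ (-B) := by
  rw [← Real.rpow_natCast R n, ← Real.rpow_mul hR]
  congr 1
  ring

/-- On the Siegel cone, a lower bound `m₀ ≤ bⱼ` (`m₀ ≤ 1`) for all coordinates of a vector with
`∏ bⱼ = 1` bounds the inverse coordinates below by `m₀ⁿ`: `m₀ⁿ ≤ bⱼ⁻¹`. [folklore] -/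
theorem pow_le_inv_of_prod_eq_one {m₀ : ℝ} (hm₀ : 0 < m₀) (hm₀1 : m₀ ≤ 1) {b : Fin n → ℝ≥0ˣ}
    (hprod : ∏ i, ((b i : ℝ≥0) : ℝ) = 1) (hle : ∀ j, m₀ ≤ ((b j : ℝ≥0) : ℝ)) (j : Fin n) :
    m₀ ^ n ≤ ((b j : ℝ≥0) : ℝ)⁻¹ := by
  have hbpos : ∀ i, 0 < ((b i : ℝ≥0) : ℝ) := fun i =>
    NNReal.coe_pos.2 (pos_iff_ne_zero.2 (b i).ne_zero)
  have hsplit : ((b j : ℝ≥0) : ℝ) * ∏ i ∈ Finset.univ.erase j, ((b i : ℝ≥0) : ℝ) = 1 := by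
    have h := hprod
    rw [← Finset.mul_prod_erase Finset.univ _ (Finset.mem_univ j)] at h
    exact h
  have herase : m₀ ^ (n - 1) ≤ ∏ i ∈ Finset.univ.erase j, ((b i : ℝ≥0) : ℝ) := by
    calc m₀ ^ (n - 1) = ∏ _i ∈ Finset.univ.erase j, m₀ := by
          rw [Finset.prod_const, Finset.card_erase_of_mem (Finset.mem_univ j), Finset.card_univ,
            Fintype.card_fin]
      _ ≤ ∏ i ∈ Finset.univ.erase j, ((b i : ℝ≥0) : ℝ) :=
          Finset.prod_le_prod (fun _ _ => hm₀.le) fun i _ => hle i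
  have h1 : ((b j : ℝ≥0) : ℝ) * m₀ ^ (n - 1) ≤ 1 := by
    calc ((b j : ℝ≥0) : ℝ) * m₀ ^ (n - 1) ≤ ((b j : ℝ≥0) : ℝ) * ∏ i ∈ Finset.univ.erase j, ((b i : ℝ≥0) : ℝ) :=
          mul_le_mul_of_nonneg_left herase (hbpos j).le
      _ = 1 := hsplit
  have h2 : m₀ ^ n ≤ m₀ ^ (n - 1) := pow_le_pow_of_le_one hm₀.le hm₀1 (Nat.sub_le n 1)
  rw [le_inv_comm₀ (pow_pos hm₀ n) (hbpos j)]
  calc ((b j : ℝ≥0) : ℝ) = ((b j : ℝ≥0) : ℝ) * m₀ ^ (n - 1) * (m₀ ^ (n - 1))⁻¹ := by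
        rw [mul_inv_cancel_right₀ (pow_pos hm₀ _).ne']
    _ ≤ 1 * (m₀ ^ (n - 1))⁻¹ := mul_le_mul_of_nonneg_right h1 (inv_nonneg.2 (pow_nonneg hm₀.le _))
    _ = (m₀ ^ (n - 1))⁻¹ := one_mul _
    _ ≤ (m₀ ^ n)⁻¹ := inv_anti₀ (pow_pos hm₀ n) h2

/-- **The dual Rankin–Selberg majorant is integrable over a Siegel set.** For a Haar measure `μ_G`
on `GL_n(𝔸_K)`, a Haar measure `ν` on `𝔸_Kˣ`, `Ψ ∈ piSchwartzBruhat K (Fin n)`, `σ > 1`, a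
continuous rapidly decreasing `φ` and Siegel data `Z ⊆ A_G`, `Ω ⊆ B(𝔸_K)` compact, `t > 0`:
`∫_{Z Ω A_{T₀}(t) K} |φ(g)|² 𝓜(Ψ, σ, ᵗg⁻¹) dμ_G(g) < ∞`,
`𝓜(Ψ, σ, h) = ∑_p ∫ |Ψ(a ξ_p h)| |a|^{nσ} dν(a)`. This is the term of the Rankin–Selberg integrand
coming from the reflected part `|det g|^{s-1} ∫_{|a| ≥ 1} Θ'_{Φ̂}(a, ᵗg⁻¹) |a|^{n(1-s)}` of the
Eisenstein series (Cogdell (2004), §2.3, p. 210; `norm_sub_one_mul_mirabolicEisenstein_sub_le` with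
`Ψ = Φ̂`). Same proof as `setLIntegral_siegel_normSq_mul_majorant_lt_top`: for `g = a · y`
(`a = diag(z(b))` on the cone, `y` in a fixed compact set) one has `ᵗg⁻¹ = diag(z(b⁻¹)) · ᵗy⁻¹` with
`bⱼ⁻¹ ≥ ((Tⁿ Rⁿ)⁻¹)ⁿ` (`inv_le_of_siegelCone`, `pow_le_inv_of_prod_eq_one`), so the majorant grows at
most polynomially in the largest simple root `R` (`exists_tsum_lintegral_vecMul_mul_le_of_mem_piSchwartzBruhat`)
while `|φ(a y)| ≤ C_φ R^{-B}` for every `B`; the integrand is bounded on the Siegel set, which has finite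
measure (`measure_mul_siegelSet_lt_top`). [cite: CogdellAnalyticTheory2004, §2.3, pp. 210–211] -/
theorem setLIntegral_siegel_normSq_mul_dualMajorant_lt_top
    [MeasurableSpace (GL (Fin n) (AdeleRing (𝓞 K) K))] [BorelSpace (GL (Fin n) (AdeleRing (𝓞 K) K))]
    (μG : Measure (GL (Fin n) (AdeleRing (𝓞 K) K))) [μG.IsHaarMeasure]
    (ν : Measure (GaloisRepresentations.ideleGroup K)) [ν.IsHaarMeasure]
    {Ψ : (Fin n → AdeleRing (𝓞 K) K) → ℂ} (hΨ : Ψ ∈ piSchwartzBruhat K (Fin n)) {σ : ℝ} (hσ : 1 < σ)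
    {φ : (AdelicGroupData.gl n K).Adelic → ℂ} (hφc : Continuous φ) (hφ : IsRapidlyDecreasingGL n K φ)
    {Ω : Set (GL (Fin n) (AdeleRing (𝓞 K) K))} (hΩc : IsCompact Ω)
    (hΩB : Ω ⊆ (standardParabolicGL (AdeleRing (𝓞 K) K) (id : Fin n → Fin n) :
      Set (GL (Fin n) (AdeleRing (𝓞 K) K))))
    {t : ℝ} (ht : 0 < t) {Z : Set (GL (Fin n) (AdeleRing (𝓞 K) K))} (hZc : IsCompact Z)
    (hZ : Z ⊆ Set.range (posRealScalar n K)) :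
    ∫⁻ g in Z * (Ω * siegelCone n K t *
        (standardMaximalCompactGL n K : Set (GL (Fin n) (AdeleRing (𝓞 K) K)))),
      (‖φ g‖ₑ : ℝ≥0∞) ^ 2 *
        ∑' p : Projectivization K (Fin n → K),
          ∫⁻ a, (‖Ψ ((a : AdeleRing (𝓞 K) K) •
              (ratVec K p.rep ᵥ* ((glTransposeInv g : GL (Fin n) (AdeleRing (𝓞 K) K)) :
                Matrix (Fin n) (Fin n) (AdeleRing (𝓞 K) K))))‖ₑ : ℝ≥0∞) *
            ENNReal.ofReal ((IdeleClassGroup.ideleNorm K a : ℝ) ^ ((n : ℝ) * σ)) ∂ν ∂μG < ⊤ := by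
  have hmeq := ‹BorelSpace (GL (Fin n) (AdeleRing (𝓞 K) K))›.measurable_eq
  subst hmeq
  letI : MeasurableSpace (GL (Fin n) (AdeleRing (𝓞 K) K)) := borel _
  haveI : T2Space (GL (Fin n) (AdeleRing (𝓞 K) K)) := t2Space_gl n K
  have hKc : IsCompact (standardMaximalCompactGL n K : Set (GL (Fin n) (AdeleRing (𝓞 K) K))) :=
    isCompact_standardMaximalCompactGL n K
  set S : Set (GL (Fin n) (AdeleRing (𝓞 K) K)) := Z * (Ω * siegelCone n K t *
    (standardMaximalCompactGL n K : Set (GL (Fin n) (AdeleRing (𝓞 K) K)))) with hS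
  have hSm : MeasurableSet S := measurableSet_mul_siegelSet n K hZc hΩc ht
  have hSfin : μG S < ⊤ := measure_mul_siegelSet_lt_top μG hΩc hΩB ht hZc hZ
  -- the integrand
  set F : GL (Fin n) (AdeleRing (𝓞 K) K) → ℝ≥0∞ := fun g =>
    (‖φ g‖ₑ : ℝ≥0∞) ^ 2 *
      ∑' p : Projectivization K (Fin n → K),
        ∫⁻ a, (‖Ψ ((a : AdeleRing (𝓞 K) K) •
            (ratVec K p.rep ᵥ* ((glTransposeInv g : GL (Fin n) (AdeleRing (𝓞 K) K)) :
              Matrix (Fin n) (Fin n) (AdeleRing (𝓞 K) K))))‖ₑ : ℝ≥0∞) *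
          ENNReal.ofReal ((IdeleClassGroup.ideleNorm K a : ℝ) ^ ((n : ℝ) * σ)) ∂ν with hF
  -- it suffices to bound the integrand on `S`
  suffices hbd : ∃ Cst : ℝ≥0∞, Cst ≠ ⊤ ∧ ∀ g ∈ S, F g ≤ Cst by
    obtain ⟨Cst, hCst, hle⟩ := hbd
    calc ∫⁻ g in S, F g ∂μG ≤ ∫⁻ _g in S, Cst ∂μG := setLIntegral_mono' hSm fun g hg => hle g hg
      _ = Cst * μG S := setLIntegral_const _ _
      _ < ⊤ := ENNReal.mul_lt_top hCst.lt_top hSfin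
  -- `n = 0`: the sum over `ℙ(K⁰) = ∅` vanishes
  rcases Nat.eq_zero_or_pos n with hn0 | hn
  · subst hn0
    haveI : IsEmpty (Projectivization K (Fin 0 → K)) :=
      ⟨fun p => p.rep_nonzero (Subsingleton.elim _ _)⟩
    refine ⟨0, ENNReal.zero_ne_top, fun g _ => ?_⟩
    simp only [hF, tsum_empty, mul_zero, le_refl]
  -- the compact set `Y = Z C K` of the decomposition `g = a · y` and its transpose-inverse `Y'`
  obtain ⟨CΩ, hCΩc, hdec⟩ := exists_siegel_decomposition hΩc hΩB ht hZ
  set Y : Set (GL (Fin n) (AdeleRing (𝓞 K) K)) := Z * CΩ *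
    (standardMaximalCompactGL n K : Set (GL (Fin n) (AdeleRing (𝓞 K) K))) with hY
  have hYc : IsCompact Y := (hZc.mul hCΩc).mul hKc
  set Y' : Set (GL (Fin n) (AdeleRing (𝓞 K) K)) := glTransposeInv '' Y with hY'
  have hY'c : IsCompact Y' := hYc.image continuous_glTransposeInv
  -- growth of the majorant along `A_T · Y'`
  obtain ⟨CM, hCM, hM⟩ := exists_tsum_lintegral_vecMul_mul_le_of_mem_piSchwartzBruhat K ν hΨ hσ hY'c
  -- rapid decay with `B = n · (n [K:ℚ] n σ / 2)`
  set B : ℝ := (n : ℝ) * ((n : ℝ) * finrank ℚ K * ((n : ℝ) * σ) / 2) with hB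
  have hB0 : 0 < B := by
    have : (0 : ℝ) < finrank ℚ K := Nat.cast_pos.2 Module.finrank_pos
    have hn' : (0 : ℝ) < n := Nat.cast_pos.2 hn
    rw [hB]; positivity
  obtain ⟨Cφ, hCφ0, hφb⟩ := exists_uniform_rapidDecay n K hφc hφ hYc ht hB0
  set T : ℝ := max 1 t⁻¹ with hT
  have hT1 : 1 ≤ T := le_max_left _ _
  have hT0 : 0 < T := one_pos.trans_le hT1
  -- the constant
  refine ⟨ENNReal.ofReal (Cφ ^ 2 * (T ^ n) ^ ((n : ℝ) * finrank ℚ K * ((n : ℝ) * σ))) * CM,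
    ENNReal.mul_ne_top ENNReal.ofReal_ne_top hCM, fun g hg => ?_⟩
  -- decompose `g = a · y`, `a = diag(z(b))`
  obtain ⟨b, hprod, hroot, y, hyY, rfl⟩ := hdec g hg
  set a : GL (Fin n) (AdeleRing (𝓞 K) K) := posRealDiagonal n K b with ha'
  -- the largest simple root `R` and the lower bound `m₀` of the coordinates
  obtain ⟨R, hR1, hRroot, hφay⟩ := hφb b hprod hroot y hyY
  have hR0 : 0 < R := one_pos.trans_le hR1
  set m₀ : ℝ := (T ^ n * R ^ n)⁻¹ with hm₀
  have hTR1 : 1 ≤ T ^ n * R ^ n := one_le_mul_of_one_le_of_one_le (one_le_pow₀ hT1) (one_le_pow₀ hR1)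
  have hm₀pos : 0 < m₀ := inv_pos.2 (one_pos.trans_le hTR1)
  have hm₀1 : m₀ ≤ 1 := inv_le_one_of_one_le₀ hTR1
  have hm₀le : ∀ j, m₀ ≤ ((b j : ℝ≥0) : ℝ) := fun j =>
    inv_le_of_siegelCone ht hn hprod hroot hR1 hRroot j
  -- the inverse coordinates are `≥ m₁ = m₀ⁿ`
  set m₁r : ℝ := m₀ ^ n with hm₁r
  have hm₁pos : 0 < m₁r := pow_pos hm₀pos n
  set m₁ : ℝ≥0ˣ := Units.mk0 ⟨m₁r, hm₁pos.le⟩ (by rw [Ne, ← NNReal.coe_eq_zero]; exact hm₁pos.ne')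
    with hm₁
  have hmb : ∀ j, (m₁ : ℝ≥0) ≤ (b⁻¹ j : ℝ≥0) := by
    intro j
    rw [← NNReal.coe_le_coe, Pi.inv_apply, Units.val_inv_eq_inv_val, NNReal.coe_inv]
    exact pow_le_inv_of_prod_eq_one hm₀pos hm₀1 hprod hm₀le j
  -- the majorant at `ᵗ(a y)⁻¹ = diag(z(b⁻¹)) ᵗy⁻¹`
  have hy'Y' : glTransposeInv y ∈ Y' := Set.mem_image_of_mem _ hyY
  have htrans : glTransposeInv (a * y) = posRealDiagonal n K b⁻¹ * glTransposeInv y := by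
    rw [glTransposeInv_mul, ha', glTransposeInv_posRealDiagonal]
  have hMay := hM (glTransposeInv y) hy'Y' m₁ b⁻¹ hmb
  rw [← htrans] at hMay
  -- rapid decay
  have hφ' : (‖φ (a * y)‖ₑ : ℝ≥0∞) ^ 2 ≤ ENNReal.ofReal ((Cφ * R ^ (-B)) ^ 2) := by
    rw [← ofReal_norm, ← ENNReal.ofReal_pow (norm_nonneg _)]
    exact ENNReal.ofReal_le_ofReal (pow_le_pow_left₀ (norm_nonneg _) hφay 2)
  -- bookkeeping: with `T'' = Tⁿ`, `R'' = Rⁿ`, `m₁ = (T''ⁿ R''ⁿ)⁻¹` and `R^{-B} = R''^{-(n d e / 2)}`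
  have hTn0 : 0 < T ^ n := pow_pos hT0 n
  have hRn0 : 0 < R ^ n := pow_pos hR0 n
  have hm₁val : ((m₁ : ℝ≥0) : ℝ) = ((T ^ n) ^ n * (R ^ n) ^ n)⁻¹ := by
    change m₀ ^ n = _
    rw [hm₀, inv_pow, mul_pow]
  have hRB : R ^ (-B) = (R ^ n) ^ (-((n : ℝ) * finrank ℚ K * ((n : ℝ) * σ) / 2)) := by
    rw [hB, rpow_neg_natCast_mul hR0.le]
  have hbook := cone_bookkeeping (C := Cφ) (e := (n : ℝ) * σ) hTn0 hRn0 n (finrank ℚ K)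
  calc F (a * y)
      ≤ ENNReal.ofReal ((Cφ * R ^ (-B)) ^ 2) *
          (ENNReal.ofReal ((((m₁ : ℝ≥0) : ℝ) ^ finrank ℚ K) ^ (-((n : ℝ) * σ))) * CM) := by
        simp only [hF]
        exact mul_le_mul' hφ' hMay
    _ = ENNReal.ofReal ((Cφ * R ^ (-B)) ^ 2 * ((((m₁ : ℝ≥0) : ℝ) ^ finrank ℚ K) ^ (-((n : ℝ) * σ)))) * CM := by
        rw [ENNReal.ofReal_mul (sq_nonneg _), mul_assoc]
    _ = ENNReal.ofReal (Cφ ^ 2 * (T ^ n) ^ ((n : ℝ) * finrank ℚ K * ((n : ℝ) * σ))) * CM := by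
        rw [hm₁val, hRB, hbook]

end DualFiniteness

/-! ### The residue of the Rankin–Selberg integral at `s = 1` -/

section Residue

variable {K}

/-- **Measurability of the Eisenstein majorants in `g`.** For a continuous `Ψ` on `𝔸_Kⁿ`, a real `τ`,
an s-finite measure `ν` on `𝔸_Kˣ` and a continuous `T : GL_n(𝔸_K) → GL_n(𝔸_K)`, the majorant
`g ↦ ∑_p ∫ |Ψ(a ξ_p T(g))| |a|^τ dν(a)` is Borel measurable (Tonelli measurability of the sections of a
jointly continuous kernel, and a countable sum). [folklore] -/
theorem measurable_tsum_lintegral_enorm_smul_vecMul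
    [MeasurableSpace (GL (Fin n) (AdeleRing (𝓞 K) K))] [BorelSpace (GL (Fin n) (AdeleRing (𝓞 K) K))]
    (ν : Measure (GaloisRepresentations.ideleGroup K)) [SFinite ν]
    {Ψ : (Fin n → AdeleRing (𝓞 K) K) → ℂ} (hΨc : Continuous Ψ) (τ : ℝ)
    {T : GL (Fin n) (AdeleRing (𝓞 K) K) → GL (Fin n) (AdeleRing (𝓞 K) K)} (hT : Continuous T) :
    Measurable fun g : GL (Fin n) (AdeleRing (𝓞 K) K) => ∑' p : Projectivization K (Fin n → K),
      ∫⁻ a, (‖Ψ ((a : AdeleRing (𝓞 K) K) •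
          (ratVec K p.rep ᵥ* ((T g : GL (Fin n) (AdeleRing (𝓞 K) K)) :
            Matrix (Fin n) (Fin n) (AdeleRing (𝓞 K) K))))‖ₑ : ℝ≥0∞) *
        ENNReal.ofReal ((IdeleClassGroup.ideleNorm K a : ℝ) ^ τ) ∂ν := by
  haveI := countable_projectivization K (n := n)
  haveI : SecondCountableTopology (GL (Fin n) (AdeleRing (𝓞 K) K)) :=
    secondCountableTopology_generalLinearGroup_adeleRing K (Fin n)
  have hc : Continuous fun a : GaloisRepresentations.ideleGroup K =>
      (IdeleClassGroup.ideleNorm K a : ℝ) ^ τ :=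
    (NNReal.continuous_coe.comp (continuous_ideleNorm_holds K)).rpow_const fun a =>
      Or.inl (NNReal.coe_ne_zero.2 (ideleNorm_ne_zero a))
  have hF : ∀ p : Projectivization K (Fin n → K), Measurable fun q :
      GL (Fin n) (AdeleRing (𝓞 K) K) × GaloisRepresentations.ideleGroup K =>
      (‖Ψ ((q.2 : AdeleRing (𝓞 K) K) •
          (ratVec K p.rep ᵥ* ((T q.1 : GL (Fin n) (AdeleRing (𝓞 K) K)) :
            Matrix (Fin n) (Fin n) (AdeleRing (𝓞 K) K))))‖ₑ : ℝ≥0∞) *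
        ENNReal.ofReal ((IdeleClassGroup.ideleNorm K q.2 : ℝ) ^ τ) := by
    intro p
    refine Measurable.mul (Continuous.measurable ?_).enorm
      (ENNReal.continuous_ofReal.comp (hc.comp continuous_snd)).measurable
    exact hΨc.comp ((Units.continuous_val.comp continuous_snd).smul
      ((continuous_ratVec_vecMul K p.rep).comp (hT.comp continuous_fst)))
  simp_rw [ENNReal.tsum_eq_iSup_sum]
  refine Measurable.iSup fun P => Finset.measurable_sum P fun p _ => ?_
  exact (hF p).lintegral_prod_right'

/-- **The residual Rankin–Selberg majorant is integrable over a Siegel set.** For Haar measures `μ_G` on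
`GL_n(𝔸_K)`, `ν` on `𝔸_Kˣ`, `μ` on `𝔸_Kⁿ`, `Φ ∈ piSchwartzBruhat K (Fin n)` with transform
`Φ̂ = adelicPiFourier K (Fin n) μ Φ`, a continuous rapidly decreasing `χ`, Siegel data and finite constants
`c₁, …, c₄`:
`∫_{Z Ω A_{T₀}(t) K} |χ(g)|² (c₁ (𝓜(Φ, 2, g) + c₂ 𝓜(Φ̂, 2, ᵗg⁻¹) + c₃) + c₄) dμ_G(g) < ∞` — the three
pieces by `setLIntegral_siegel_normSq_mul_majorant_lt_top_of_mem_piSchwartzBruhat`,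
`setLIntegral_siegel_normSq_mul_dualMajorant_lt_top` (with `Ψ = Φ̂ ∈ piSchwartzBruhat`,
`adelicPiFourier_mem_piSchwartzBruhat`) and boundedness of `χ` on the Siegel set
(`exists_norm_le_on_siegelSet`, `measure_mul_siegelSet_lt_top`). This is the integrability of the bound of
`norm_sub_one_mul_mirabolicEisenstein_sub_le` against `|χ|²`. [cite: CogdellAnalyticTheory2004, §2.3, p. 211] -/
theorem setLIntegral_siegel_normSq_mul_residualMajorant_lt_top
    [MeasurableSpace (GL (Fin n) (AdeleRing (𝓞 K) K))] [BorelSpace (GL (Fin n) (AdeleRing (𝓞 K) K))]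
    (μG : Measure (GL (Fin n) (AdeleRing (𝓞 K) K))) [μG.IsHaarMeasure]
    (ν : Measure (GaloisRepresentations.ideleGroup K)) [ν.IsHaarMeasure]
    (μ : Measure (Fin n → AdeleRing (𝓞 K) K)) [μ.IsAddHaarMeasure]
    {Φ : (Fin n → AdeleRing (𝓞 K) K) → ℂ} (hΦ : Φ ∈ piSchwartzBruhat K (Fin n))
    {χ : (AdelicGroupData.gl n K).Adelic → ℂ} (hχc : Continuous χ) (hχd : IsRapidlyDecreasingGL n K χ)
    {Ω : Set (GL (Fin n) (AdeleRing (𝓞 K) K))} (hΩc : IsCompact Ω)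
    (hΩB : Ω ⊆ (standardParabolicGL (AdeleRing (𝓞 K) K) (id : Fin n → Fin n) :
      Set (GL (Fin n) (AdeleRing (𝓞 K) K))))
    {t : ℝ} (ht : 0 < t) {Z : Set (GL (Fin n) (AdeleRing (𝓞 K) K))} (hZc : IsCompact Z)
    (hZ : Z ⊆ Set.range (posRealScalar n K)) {c₁ c₂ c₃ c₄ : ℝ≥0∞} (hc₁ : c₁ ≠ ⊤) (hc₂ : c₂ ≠ ⊤)
    (hc₃ : c₃ ≠ ⊤) (hc₄ : c₄ ≠ ⊤) :
    ∫⁻ g in Z * (Ω * siegelCone n K t *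
        (standardMaximalCompactGL n K : Set (GL (Fin n) (AdeleRing (𝓞 K) K)))),
      (‖χ g‖ₑ : ℝ≥0∞) ^ 2 *
        (c₁ * ((∑' p : Projectivization K (Fin n → K),
            ∫⁻ a, (‖Φ ((a : AdeleRing (𝓞 K) K) •
                (ratVec K p.rep ᵥ* (g : Matrix (Fin n) (Fin n) (AdeleRing (𝓞 K) K))))‖ₑ : ℝ≥0∞) *
              ENNReal.ofReal ((IdeleClassGroup.ideleNorm K a : ℝ) ^ ((n : ℝ) * 2)) ∂ν) +
          c₂ * (∑' p : Projectivization K (Fin n → K),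
            ∫⁻ a, (‖adelicPiFourier K (Fin n) μ Φ ((a : AdeleRing (𝓞 K) K) •
                (ratVec K p.rep ᵥ* ((glTransposeInv g : GL (Fin n) (AdeleRing (𝓞 K) K)) :
                  Matrix (Fin n) (Fin n) (AdeleRing (𝓞 K) K))))‖ₑ : ℝ≥0∞) *
              ENNReal.ofReal ((IdeleClassGroup.ideleNorm K a : ℝ) ^ ((n : ℝ) * 2)) ∂ν) + c₃) + c₄) ∂μG < ⊤ := by
  have hmeq := ‹BorelSpace (GL (Fin n) (AdeleRing (𝓞 K) K))›.measurable_eq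
  subst hmeq
  letI : MeasurableSpace (GL (Fin n) (AdeleRing (𝓞 K) K)) := borel _
  haveI : T2Space (GL (Fin n) (AdeleRing (𝓞 K) K)) := t2Space_gl n K
  haveI := secondCountableTopology_ideleGroup K
  haveI := locallyCompactSpace_ideleGroup K
  set S : Set (GL (Fin n) (AdeleRing (𝓞 K) K)) := Z * (Ω * siegelCone n K t *
    (standardMaximalCompactGL n K : Set (GL (Fin n) (AdeleRing (𝓞 K) K)))) with hS
  have hSm : MeasurableSet S := measurableSet_mul_siegelSet n K hZc hΩc ht
  have hSfin : μG S < ⊤ := measure_mul_siegelSet_lt_top μG hΩc hΩB ht hZc hZ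
  have hΦhat : adelicPiFourier K (Fin n) μ Φ ∈ piSchwartzBruhat K (Fin n) :=
    adelicPiFourier_mem_piSchwartzBruhat hΦ
  -- the two majorants and their measurability
  set M₁ : GL (Fin n) (AdeleRing (𝓞 K) K) → ℝ≥0∞ := fun g => ∑' p : Projectivization K (Fin n → K),
    ∫⁻ a, (‖Φ ((a : AdeleRing (𝓞 K) K) •
        (ratVec K p.rep ᵥ* (g : Matrix (Fin n) (Fin n) (AdeleRing (𝓞 K) K))))‖ₑ : ℝ≥0∞) *
      ENNReal.ofReal ((IdeleClassGroup.ideleNorm K a : ℝ) ^ ((n : ℝ) * 2)) ∂ν with hM₁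
  set M₂ : GL (Fin n) (AdeleRing (𝓞 K) K) → ℝ≥0∞ := fun g => ∑' p : Projectivization K (Fin n → K),
    ∫⁻ a, (‖adelicPiFourier K (Fin n) μ Φ ((a : AdeleRing (𝓞 K) K) •
        (ratVec K p.rep ᵥ* ((glTransposeInv g : GL (Fin n) (AdeleRing (𝓞 K) K)) :
          Matrix (Fin n) (Fin n) (AdeleRing (𝓞 K) K))))‖ₑ : ℝ≥0∞) *
      ENNReal.ofReal ((IdeleClassGroup.ideleNorm K a : ℝ) ^ ((n : ℝ) * 2)) ∂ν with hM₂
  have hM₁m : Measurable M₁ :=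
    measurable_tsum_lintegral_enorm_smul_vecMul ν (continuous_of_mem_piSchwartzBruhat hΦ) _ continuous_id
  have hM₂m : Measurable M₂ :=
    measurable_tsum_lintegral_enorm_smul_vecMul ν (continuous_of_mem_piSchwartzBruhat hΦhat) _
      continuous_glTransposeInv
  have hχm : Measurable fun g : GL (Fin n) (AdeleRing (𝓞 K) K) => (‖χ g‖ₑ : ℝ≥0∞) ^ 2 :=
    (show Continuous fun g : GL (Fin n) (AdeleRing (𝓞 K) K) => χ g from hχc).measurable.enorm.pow_const 2
  have hf₁ : Measurable fun g : GL (Fin n) (AdeleRing (𝓞 K) K) => c₁ * ((‖χ g‖ₑ : ℝ≥0∞) ^ 2 * M₁ g) :=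
    (hχm.mul hM₁m).const_mul c₁
  have hf₂ : Measurable fun g : GL (Fin n) (AdeleRing (𝓞 K) K) =>
      c₁ * c₂ * ((‖χ g‖ₑ : ℝ≥0∞) ^ 2 * M₂ g) :=
    (hχm.mul hM₂m).const_mul (c₁ * c₂)
  have hm₁ : Measurable fun g : GL (Fin n) (AdeleRing (𝓞 K) K) => (‖χ g‖ₑ : ℝ≥0∞) ^ 2 * M₁ g :=
    hχm.mul hM₁m
  have hm₂ : Measurable fun g : GL (Fin n) (AdeleRing (𝓞 K) K) => (‖χ g‖ₑ : ℝ≥0∞) ^ 2 * M₂ g :=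
    hχm.mul hM₂m
  -- the three finite pieces
  have h1 : ∫⁻ g in S, (‖χ g‖ₑ : ℝ≥0∞) ^ 2 * M₁ g ∂μG < ⊤ :=
    setLIntegral_siegel_normSq_mul_majorant_lt_top_of_mem_piSchwartzBruhat K μG ν hΦ one_lt_two hχc hχd
      hΩc hΩB ht hZc hZ
  have h2 : ∫⁻ g in S, (‖χ g‖ₑ : ℝ≥0∞) ^ 2 * M₂ g ∂μG < ⊤ :=
    setLIntegral_siegel_normSq_mul_dualMajorant_lt_top K μG ν hΦhat one_lt_two hχc hχd hΩc hΩB ht hZc hZ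
  obtain ⟨Cχ, hCχ0, hχb⟩ := exists_norm_le_on_siegelSet hχc hχd hΩc hΩB ht hZc hZ
  have h3 : ∫⁻ g in S, (‖χ g‖ₑ : ℝ≥0∞) ^ 2 ∂μG < ⊤ := by
    calc ∫⁻ g in S, (‖χ g‖ₑ : ℝ≥0∞) ^ 2 ∂μG ≤ ∫⁻ _g in S, ENNReal.ofReal (Cχ ^ 2) ∂μG := by
          refine setLIntegral_mono' hSm fun g hg => ?_
          rw [← ofReal_norm, ← ENNReal.ofReal_pow (norm_nonneg _)]
          exact ENNReal.ofReal_le_ofReal (pow_le_pow_left₀ (norm_nonneg _) (hχb g hg) 2)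
      _ = ENNReal.ofReal (Cχ ^ 2) * μG S := setLIntegral_const _ _
      _ < ⊤ := ENNReal.mul_lt_top ENNReal.ofReal_lt_top hSfin
  -- split the integrand
  change ∫⁻ g in S, (‖χ g‖ₑ : ℝ≥0∞) ^ 2 * (c₁ * (M₁ g + c₂ * M₂ g + c₃) + c₄) ∂μG < ⊤
  calc ∫⁻ g in S, (‖χ g‖ₑ : ℝ≥0∞) ^ 2 * (c₁ * (M₁ g + c₂ * M₂ g + c₃) + c₄) ∂μG
      = ∫⁻ g in S, c₁ * ((‖χ g‖ₑ : ℝ≥0∞) ^ 2 * M₁ g) + (c₁ * c₂ * ((‖χ g‖ₑ : ℝ≥0∞) ^ 2 * M₂ g) +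
          (c₁ * c₃ + c₄) * (‖χ g‖ₑ : ℝ≥0∞) ^ 2) ∂μG := lintegral_congr fun g => by ring
    _ = c₁ * ∫⁻ g in S, (‖χ g‖ₑ : ℝ≥0∞) ^ 2 * M₁ g ∂μG +
          (c₁ * c₂ * ∫⁻ g in S, (‖χ g‖ₑ : ℝ≥0∞) ^ 2 * M₂ g ∂μG +
            (c₁ * c₃ + c₄) * ∫⁻ g in S, (‖χ g‖ₑ : ℝ≥0∞) ^ 2 ∂μG) := by
        rw [lintegral_add_left hf₁, lintegral_add_left hf₂, lintegral_const_mul _ hm₁,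
          lintegral_const_mul _ hm₂, lintegral_const_mul _ hχm]
    _ < ⊤ := by
        refine ENNReal.add_lt_top.2 ⟨ENNReal.mul_lt_top hc₁.lt_top h1, ENNReal.add_lt_top.2
          ⟨ENNReal.mul_lt_top (ENNReal.mul_lt_top hc₁.lt_top hc₂.lt_top) h2,
            ENNReal.mul_lt_top (ENNReal.add_lt_top.2
              ⟨ENNReal.mul_lt_top hc₁.lt_top hc₃.lt_top, hc₄.lt_top⟩) h3⟩⟩

variable (ν : Measure (GaloisRepresentations.ideleGroup K)) [ν.IsHaarMeasure]

/-- **The residual term of `(s - 1) E(g, Φ; s)` against the constant `R = c_D V Φ̂(0) / n`, pointwise.**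
With `Ng = |det g|`, if `Ng ≤ D₂` (`D₂ ≥ 1`), `|det g|⁻¹ ≤ A`, `|log Ng| ≤ L` (`L ≥ 0`), `1 < re s ≤ 2`
and `‖s - 1‖ L ≤ 1`, then
`‖(s - 1) E(g, Φ; s) - R‖ ≤ ‖s - 1‖ (D₂² (𝓜(Φ, 2, g) + c_D A 𝓜(Φ̂, 2, ᵗg⁻¹) + V |Φ(0)| / n) + 2 ‖R‖ L)`
(stated in `[0, ∞]`): `norm_sub_one_mul_mirabolicEisenstein_sub_le` controls
`(s - 1) E(g, Φ; s) - R Ng^{s-1}`, and `‖Ng^{s-1} - 1‖ = ‖exp((s-1) log Ng) - 1‖ ≤ 2 ‖s - 1‖ L`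
(`Complex.norm_exp_sub_one_le`). [cite: CogdellAnalyticTheory2004, §2.3, pp. 210–211] -/
theorem enorm_sub_one_mul_mirabolicEisenstein_sub_residue_le (hn : 0 < n)
    (μ : Measure (Fin n → AdeleRing (𝓞 K) K)) [μ.IsAddHaarMeasure]
    {Φ : (Fin n → AdeleRing (𝓞 K) K) → ℂ} (hΦ : Φ ∈ piSchwartzBruhat K (Fin n))
    {D₂ A L : ℝ} (hD₂ : 1 ≤ D₂) (hL : 0 ≤ L) {g : GL (Fin n) (AdeleRing (𝓞 K) K)}
    (hgD : (IdeleClassGroup.ideleNorm K (Matrix.GeneralLinearGroup.det g) : ℝ) ≤ D₂)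
    (hgA : ((adelicAbsDet n K g⁻¹ : ℝ≥0) : ℝ) ≤ A)
    (hgL : |Real.log (IdeleClassGroup.ideleNorm K (Matrix.GeneralLinearGroup.det g) : ℝ)| ≤ L)
    {s : ℂ} (hs1 : 1 < s.re) (hs2 : s.re ≤ 2) (hsL : ‖s - 1‖ * L ≤ 1) :
    (‖(s - 1) * mirabolicEisenstein K ν Φ s g -
        (((μ (piFundamentalDomain K (Fin n))).toReal⁻¹ : ℝ) : ℂ) * ((idelicCovolume K ν).toReal : ℂ) *
          (∫ v, Φ v ∂μ) / n‖ₑ : ℝ≥0∞) ≤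
      ‖s - 1‖ₑ *
        (ENNReal.ofReal (D₂ ^ 2) *
          ((∑' p : Projectivization K (Fin n → K),
              ∫⁻ a, (‖Φ ((a : AdeleRing (𝓞 K) K) •
                  (ratVec K p.rep ᵥ* (g : Matrix (Fin n) (Fin n) (AdeleRing (𝓞 K) K))))‖ₑ : ℝ≥0∞) *
                ENNReal.ofReal ((IdeleClassGroup.ideleNorm K a : ℝ) ^ ((n : ℝ) * 2)) ∂ν) +
            ENNReal.ofReal ((μ (piFundamentalDomain K (Fin n))).toReal⁻¹ * A) *
              (∑' p : Projectivization K (Fin n → K),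
                ∫⁻ a, (‖adelicPiFourier K (Fin n) μ Φ ((a : AdeleRing (𝓞 K) K) •
                    (ratVec K p.rep ᵥ* ((glTransposeInv g : GL (Fin n) (AdeleRing (𝓞 K) K)) :
                      Matrix (Fin n) (Fin n) (AdeleRing (𝓞 K) K))))‖ₑ : ℝ≥0∞) *
                  ENNReal.ofReal ((IdeleClassGroup.ideleNorm K a : ℝ) ^ ((n : ℝ) * 2)) ∂ν) +
            ENNReal.ofReal ((idelicCovolume K ν).toReal * ‖Φ 0‖ / n)) +
          ENNReal.ofReal (2 * ‖(((μ (piFundamentalDomain K (Fin n))).toReal⁻¹ : ℝ) : ℂ) *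
            ((idelicCovolume K ν).toReal : ℂ) * (∫ v, Φ v ∂μ) / n‖ * L)) := by
  -- notation
  set Ng : ℝ := (IdeleClassGroup.ideleNorm K (Matrix.GeneralLinearGroup.det g) : ℝ) with hNg
  have hNgpos : 0 < Ng := ideleNorm_real_pos _
  set cD : ℝ := (μ (piFundamentalDomain K (Fin n))).toReal⁻¹ with hcD
  set Vr : ℝ := (idelicCovolume K ν).toReal with hVr
  set R : ℂ := ((cD : ℝ) : ℂ) * ((Vr : ℝ) : ℂ) * (∫ v, Φ v ∂μ) / n with hR
  set M₁ : ℝ≥0∞ := ∑' p : Projectivization K (Fin n → K),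
    ∫⁻ a, (‖Φ ((a : AdeleRing (𝓞 K) K) •
        (ratVec K p.rep ᵥ* (g : Matrix (Fin n) (Fin n) (AdeleRing (𝓞 K) K))))‖ₑ : ℝ≥0∞) *
      ENNReal.ofReal ((IdeleClassGroup.ideleNorm K a : ℝ) ^ ((n : ℝ) * 2)) ∂ν with hM₁
  set M₂ : ℝ≥0∞ := ∑' p : Projectivization K (Fin n → K),
    ∫⁻ a, (‖adelicPiFourier K (Fin n) μ Φ ((a : AdeleRing (𝓞 K) K) •
        (ratVec K p.rep ᵥ* ((glTransposeInv g : GL (Fin n) (AdeleRing (𝓞 K) K)) :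
          Matrix (Fin n) (Fin n) (AdeleRing (𝓞 K) K))))‖ₑ : ℝ≥0∞) *
      ENNReal.ofReal ((IdeleClassGroup.ideleNorm K a : ℝ) ^ ((n : ℝ) * 2)) ∂ν with hM₂
  set d' : ℝ := ((adelicAbsDet n K g⁻¹ : ℝ≥0) : ℝ) with hd'
  have hd'0 : 0 ≤ d' := NNReal.coe_nonneg _
  have hA0 : 0 ≤ A := hd'0.trans hgA
  have hcD0 : 0 ≤ cD := inv_nonneg.2 ENNReal.toReal_nonneg
  have hVr0 : 0 ≤ Vr := ENNReal.toReal_nonneg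
  have hn0 : (0 : ℝ) < n := Nat.cast_pos.2 hn
  -- the bound of `MirabolicEisensteinResidueBound`
  have h1 := norm_sub_one_mul_mirabolicEisenstein_sub_le ν hn μ hΦ g hs1 hs2
  have hRNg : ((cD : ℝ) : ℂ) * ((Vr : ℝ) : ℂ) * (∫ v, Φ v ∂μ) * ((Ng : ℝ) : ℂ) ^ (s - 1) / n =
      R * ((Ng : ℝ) : ℂ) ^ (s - 1) := by
    simp only [hR]
    ring
  rw [hRNg] at h1
  -- the second piece `‖R Ng^{s-1} - R‖ ≤ 2 ‖R‖ ‖s - 1‖ L`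
  have h2 : ‖R * ((Ng : ℝ) : ℂ) ^ (s - 1) - R‖ ≤ ‖R‖ * (2 * (‖s - 1‖ * L)) := by
    rw [← mul_sub_one, norm_mul]
    refine mul_le_mul_of_nonneg_left ?_ (norm_nonneg _)
    have hcpow : ((Ng : ℝ) : ℂ) ^ (s - 1) = Complex.exp (((Real.log Ng : ℝ) : ℂ) * (s - 1)) := by
      rw [Complex.cpow_def_of_ne_zero (Complex.ofReal_ne_zero.2 hNgpos.ne'), Complex.ofReal_log hNgpos.le]
    have hw : ‖((Real.log Ng : ℝ) : ℂ) * (s - 1)‖ ≤ ‖s - 1‖ * L := by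
      rw [norm_mul, Complex.norm_real, Real.norm_eq_abs, mul_comm]
      exact mul_le_mul_of_nonneg_left hgL (norm_nonneg _)
    rw [hcpow]
    calc ‖Complex.exp (((Real.log Ng : ℝ) : ℂ) * (s - 1)) - 1‖
        ≤ 2 * ‖((Real.log Ng : ℝ) : ℂ) * (s - 1)‖ := Complex.norm_exp_sub_one_le (hw.trans hsL)
      _ ≤ 2 * (‖s - 1‖ * L) := mul_le_mul_of_nonneg_left hw two_pos.le
  -- `Ng^{re s} ≤ D₂²`
  have hNgre : Ng ^ s.re ≤ D₂ ^ 2 := by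
    calc Ng ^ s.re ≤ D₂ ^ s.re := Real.rpow_le_rpow hNgpos.le hgD (by linarith)
      _ ≤ D₂ ^ (2 : ℝ) := Real.rpow_le_rpow_of_exponent_le hD₂ hs2
      _ = D₂ ^ 2 := Real.rpow_two D₂
  -- the real bound
  have h3 : ‖(s - 1) * mirabolicEisenstein K ν Φ s g - R‖ ≤
      ‖s - 1‖ * (D₂ ^ 2 * (M₁.toReal + cD * A * M₂.toReal + Vr * ‖Φ 0‖ / n) + 2 * ‖R‖ * L) := by
    have hM₁0 : 0 ≤ M₁.toReal := ENNReal.toReal_nonneg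
    have hM₂0 : 0 ≤ M₂.toReal := ENNReal.toReal_nonneg
    have hin : M₁.toReal + cD * d' * M₂.toReal + Vr * ‖Φ 0‖ / n ≤
        M₁.toReal + cD * A * M₂.toReal + Vr * ‖Φ 0‖ / n := by
      have : cD * d' * M₂.toReal ≤ cD * A * M₂.toReal :=
        mul_le_mul_of_nonneg_right (mul_le_mul_of_nonneg_left hgA hcD0) hM₂0
      linarith
    have hin0 : 0 ≤ M₁.toReal + cD * d' * M₂.toReal + Vr * ‖Φ 0‖ / n := by positivity
    calc ‖(s - 1) * mirabolicEisenstein K ν Φ s g - R‖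
        ≤ ‖(s - 1) * mirabolicEisenstein K ν Φ s g - R * ((Ng : ℝ) : ℂ) ^ (s - 1)‖ +
            ‖R * ((Ng : ℝ) : ℂ) ^ (s - 1) - R‖ := norm_sub_le_norm_sub_add_norm_sub _ _ _
      _ ≤ ‖s - 1‖ * Ng ^ s.re * (M₁.toReal + cD * d' * M₂.toReal + Vr * ‖Φ 0‖ / n) +
            ‖R‖ * (2 * (‖s - 1‖ * L)) := add_le_add h1 h2
      _ ≤ ‖s - 1‖ * D₂ ^ 2 * (M₁.toReal + cD * A * M₂.toReal + Vr * ‖Φ 0‖ / n) +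
            ‖R‖ * (2 * (‖s - 1‖ * L)) := by
          refine add_le_add (mul_le_mul (mul_le_mul_of_nonneg_left hNgre (norm_nonneg _)) hin hin0
            (mul_nonneg (norm_nonneg _) (sq_nonneg _))) le_rfl
      _ = ‖s - 1‖ * (D₂ ^ 2 * (M₁.toReal + cD * A * M₂.toReal + Vr * ‖Φ 0‖ / n) + 2 * ‖R‖ * L) := by
          ring
  -- to `[0, ∞]`
  have hX0 : 0 ≤ D₂ ^ 2 * (M₁.toReal + cD * A * M₂.toReal + Vr * ‖Φ 0‖ / n) := by positivity
  have hY0 : 0 ≤ 2 * ‖R‖ * L := by positivity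
  calc (‖(s - 1) * mirabolicEisenstein K ν Φ s g - R‖ₑ : ℝ≥0∞)
      = ENNReal.ofReal ‖(s - 1) * mirabolicEisenstein K ν Φ s g - R‖ := (ofReal_norm _).symm
    _ ≤ ENNReal.ofReal (‖s - 1‖ *
          (D₂ ^ 2 * (M₁.toReal + cD * A * M₂.toReal + Vr * ‖Φ 0‖ / n) + 2 * ‖R‖ * L)) :=
        ENNReal.ofReal_le_ofReal h3
    _ = ‖s - 1‖ₑ * (ENNReal.ofReal (D₂ ^ 2) * (ENNReal.ofReal M₁.toReal +
          ENNReal.ofReal (cD * A) * ENNReal.ofReal M₂.toReal + ENNReal.ofReal (Vr * ‖Φ 0‖ / n)) +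
          ENNReal.ofReal (2 * ‖R‖ * L)) := by
        rw [ENNReal.ofReal_mul (norm_nonneg _), ofReal_norm, ENNReal.ofReal_add hX0 hY0,
          ENNReal.ofReal_mul (sq_nonneg _), ENNReal.ofReal_add (by positivity) (by positivity),
          ENNReal.ofReal_add ENNReal.toReal_nonneg (by positivity),
          ENNReal.ofReal_mul (mul_nonneg hcD0 hA0)]
    _ ≤ ‖s - 1‖ₑ * (ENNReal.ofReal (D₂ ^ 2) * (M₁ + ENNReal.ofReal (cD * A) * M₂ +
          ENNReal.ofReal (Vr * ‖Φ 0‖ / n)) + ENNReal.ofReal (2 * ‖R‖ * L)) := by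
        gcongr
        · exact ENNReal.ofReal_toReal_le
        · exact ENNReal.ofReal_toReal_le

/-- **The residue of the global Rankin–Selberg integral at `s = 1`** (Jacquet–Shalika (1981), §4;
Cogdell (2004), §2.3, p. 211: "the residue at `s = 1 - iσ` … `Res I(s; φ, φ', Φ) = c Φ̂(0) ∫ φ̃ φ̃' |det|^{iσ}`",
here `η = 1`, `σ = 0`). For an automorphic measure `μ'` on `GL_n(𝔸_K) ⧸ A_G GL_n(K)` (`n ≥ 1`), Haar
measures `ν` on `𝔸_Kˣ` and `μ` on `𝔸_Kⁿ`, `Φ ∈ piSchwartzBruhat K (Fin n)` and continuous `φ`, `φ'` on the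
quotient whose classical functions `invQuot φ`, `invQuot φ'` are rapidly decreasing
(`IsRapidlyDecreasingGL`; e.g. smoothed `L²` cusp forms, `isRapidlyDecreasingGL_invQuot_smoothedForm`):

  `(s - 1) · rankinSelbergIntegral μ' ν Φ s φ φ' ⟶ c_D · V · Φ̂(0) / n · ∫ φ φ' dμ'`

as `s → 1` in `re s > 1`, where `Φ̂(0) = ∫ Φ dμ`, `c_D = μ(Dⁿ)⁻¹` (`D` the Tate domain) and
`V = idelicCovolume K ν` are the constants of the pole of the Eisenstein series
(`tendsto_sub_one_mul_mirabolicEisenstein`). Proof: the residual term is `O(‖s - 1‖)` **uniformly**: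
`‖(s - 1) I(s) - R ∫ φ φ'‖ ≤ ∫ |φ φ'| ‖(s - 1) E_X - R‖ dμ' ≤ c ∫_{𝔖} |φ φ'|(g) ‖(s - 1) E(g, Φ; s) - R‖ dμ_G`
(`exists_lintegral_le_mul_setLIntegral_siegel`), and on the Siegel set `𝔖` (where `|det g|` is bounded above
and below) `‖(s - 1) E(g, Φ; s) - R‖ ≤ ‖s - 1‖ H(g)` with `∫_𝔖 |φ φ'| H dμ_G < ∞`
(`enorm_sub_one_mul_mirabolicEisenstein_sub_residue_le`,
`setLIntegral_siegel_normSq_mul_residualMajorant_lt_top`). The same estimate shows that `φ φ' E_X(·, s)` is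
`μ'`-integrable for `s` near `1`, `re s > 1`, so that `rankinSelbergIntegral` is the genuine integral there.
[cite: CogdellAnalyticTheory2004, §2.3, p. 211] -/
theorem tendsto_sub_one_mul_rankinSelbergIntegral [ν.IsMulRightInvariant] (hn : 0 < n)
    (μ' : Measure (AdelicGroupData.gl n K).automorphicQuotient)
    [(AdelicGroupData.gl n K).IsAutomorphicMeasure μ']
    (μ : Measure (Fin n → AdeleRing (𝓞 K) K)) [μ.IsAddHaarMeasure]
    {Φ : (Fin n → AdeleRing (𝓞 K) K) → ℂ} (hΦ : Φ ∈ piSchwartzBruhat K (Fin n))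
    {φ φ' : (AdelicGroupData.gl n K).automorphicQuotient → ℂ} (hφc : Continuous φ) (hφ'c : Continuous φ')
    (hφd : IsRapidlyDecreasingGL n K (invQuot (AdelicGroupData.gl n K) φ))
    (hφ'd : IsRapidlyDecreasingGL n K (invQuot (AdelicGroupData.gl n K) φ')) :
    Tendsto (fun s => (s - 1) * rankinSelbergIntegral μ' ν Φ s φ φ') (𝓝[{s : ℂ | 1 < s.re}] 1)
      (𝓝 ((((μ (piFundamentalDomain K (Fin n))).toReal⁻¹ : ℝ) : ℂ) * ((idelicCovolume K ν).toReal : ℂ) *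
          (∫ v, Φ v ∂μ) / n * ∫ x, φ x * φ' x ∂μ')) := by
  -- the group, its Borel structure, a Haar measure and the Siegel domination of `μ'`
  letI : MeasurableSpace (GL (Fin n) (AdeleRing (𝓞 K) K)) := borel _
  haveI : BorelSpace (GL (Fin n) (AdeleRing (𝓞 K) K)) := ⟨rfl⟩
  haveI : T2Space (GL (Fin n) (AdeleRing (𝓞 K) K)) := t2Space_gl n K
  haveI : LocallyCompactSpace (GL (Fin n) (AdeleRing (𝓞 K) K)) :=
    AdelicGroupData.locallyCompactSpace_generalLinearGroup_adeleRing K (Fin n)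
  haveI := secondCountableTopology_ideleGroup K
  haveI := locallyCompactSpace_ideleGroup K
  set μG : Measure (GL (Fin n) (AdeleRing (𝓞 K) K)) := haar with hμG
  obtain ⟨c, Ω, t, Z, hc, ht, hΩc, hΩB, hZc, hZ, hle⟩ :=
    exists_lintegral_le_mul_setLIntegral_siegel n K μ' μG
  set S : Set (GL (Fin n) (AdeleRing (𝓞 K) K)) := Z * (Ω * siegelCone n K t *
    (standardMaximalCompactGL n K : Set (GL (Fin n) (AdeleRing (𝓞 K) K)))) with hS
  have hSm : MeasurableSet S := measurableSet_mul_siegelSet n K hZc hΩc ht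
  have hSfin : μG S < ⊤ := measure_mul_siegelSet_lt_top μG hΩc hΩB ht hZc hZ
  -- notation
  set cD : ℝ := (μ (piFundamentalDomain K (Fin n))).toReal⁻¹ with hcD
  set Vr : ℝ := (idelicCovolume K ν).toReal with hVr
  set R : ℂ := ((cD : ℝ) : ℂ) * ((Vr : ℝ) : ℂ) * (∫ v, Φ v ∂μ) / n with hR
  set P : (AdelicGroupData.gl n K).automorphicQuotient → ℂ := fun x => φ x * φ' x with hP
  set ψ : GL (Fin n) (AdeleRing (𝓞 K) K) → ℂ := invQuot (AdelicGroupData.gl n K) φ with hψ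
  set ψ' : GL (Fin n) (AdeleRing (𝓞 K) K) → ℂ := invQuot (AdelicGroupData.gl n K) φ' with hψ'
  have hmk' : Continuous fun g : GL (Fin n) (AdeleRing (𝓞 K) K) =>
      (AdelicGroupData.gl n K).toAutomorphicQuotient g :=
    (AdelicGroupData.gl n K).continuous_toAutomorphicQuotient
  have hinv : Continuous fun g : GL (Fin n) (AdeleRing (𝓞 K) K) => (g⁻¹ : GL (Fin n) (AdeleRing (𝓞 K) K)) :=
    continuous_inv
  have hmkc : Continuous fun g : GL (Fin n) (AdeleRing (𝓞 K) K) =>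
      (AdelicGroupData.gl n K).toAutomorphicQuotient g⁻¹ :=
    hmk'.comp hinv
  have hψc : Continuous ψ := hφc.comp hmkc
  have hψ'c : Continuous ψ' := hφ'c.comp hmkc
  have hPmk : ∀ g : GL (Fin n) (AdeleRing (𝓞 K) K),
      P ((AdelicGroupData.gl n K).toAutomorphicQuotient g⁻¹) = ψ g * ψ' g := fun g => rfl
  have hEg : ∀ (s : ℂ) (g : GL (Fin n) (AdeleRing (𝓞 K) K)),
      mirabolicEisensteinQuot ν Φ s ((AdelicGroupData.gl n K).toAutomorphicQuotient g⁻¹) =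
        mirabolicEisenstein K ν Φ s g := fun s g => rfl
  set M₁ : GL (Fin n) (AdeleRing (𝓞 K) K) → ℝ≥0∞ := fun g => ∑' p : Projectivization K (Fin n → K),
    ∫⁻ a, (‖Φ ((a : AdeleRing (𝓞 K) K) •
        (ratVec K p.rep ᵥ* (g : Matrix (Fin n) (Fin n) (AdeleRing (𝓞 K) K))))‖ₑ : ℝ≥0∞) *
      ENNReal.ofReal ((IdeleClassGroup.ideleNorm K a : ℝ) ^ ((n : ℝ) * 2)) ∂ν with hM₁
  set M₂ : GL (Fin n) (AdeleRing (𝓞 K) K) → ℝ≥0∞ := fun g => ∑' p : Projectivization K (Fin n → K),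
    ∫⁻ a, (‖adelicPiFourier K (Fin n) μ Φ ((a : AdeleRing (𝓞 K) K) •
        (ratVec K p.rep ᵥ* ((glTransposeInv g : GL (Fin n) (AdeleRing (𝓞 K) K)) :
          Matrix (Fin n) (Fin n) (AdeleRing (𝓞 K) K))))‖ₑ : ℝ≥0∞) *
      ENNReal.ofReal ((IdeleClassGroup.ideleNorm K a : ℝ) ^ ((n : ℝ) * 2)) ∂ν with hM₂
  -- (1) the decomposition `g = a · y` on `S` and the bounds for `|det g|`
  obtain ⟨CΩ, hCΩc, hdec⟩ := exists_siegel_decomposition hΩc hΩB ht hZ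
  set Y : Set (GL (Fin n) (AdeleRing (𝓞 K) K)) := Z * CΩ *
    (standardMaximalCompactGL n K : Set (GL (Fin n) (AdeleRing (𝓞 K) K))) with hY
  have hYc : IsCompact Y := (hZc.mul hCΩc).mul (isCompact_standardMaximalCompactGL n K)
  have hNc : Continuous fun g : GL (Fin n) (AdeleRing (𝓞 K) K) =>
      (IdeleClassGroup.ideleNorm K (Matrix.GeneralLinearGroup.det g) : ℝ) :=
    NNReal.continuous_coe.comp ((continuous_ideleNorm_holds K).comp Matrix.GeneralLinearGroup.continuous_det)
  have hNpos : ∀ g : GL (Fin n) (AdeleRing (𝓞 K) K),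
      0 < (IdeleClassGroup.ideleNorm K (Matrix.GeneralLinearGroup.det g) : ℝ) := fun g => ideleNorm_real_pos _
  obtain ⟨D, hD⟩ := hYc.exists_bound_of_continuousOn hNc.continuousOn
  obtain ⟨A₀, hA₀⟩ := hYc.exists_bound_of_continuousOn
    ((hNc.inv₀ fun g => (hNpos g).ne').continuousOn)
  obtain ⟨L₀, hL₀⟩ := hYc.exists_bound_of_continuousOn
    ((hNc.log fun g => (hNpos g).ne').continuousOn)
  set D₂ : ℝ := max D 1 with hD₂
  set A : ℝ := max A₀ 0 with hA
  set L : ℝ := max L₀ 0 with hL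
  have hD₂1 : 1 ≤ D₂ := le_max_right _ _
  have hL0 : 0 ≤ L := le_max_right _ _
  have hdetS : ∀ g ∈ S,
      (IdeleClassGroup.ideleNorm K (Matrix.GeneralLinearGroup.det g) : ℝ) ≤ D₂ ∧
      ((adelicAbsDet n K g⁻¹ : ℝ≥0) : ℝ) ≤ A ∧
      |Real.log (IdeleClassGroup.ideleNorm K (Matrix.GeneralLinearGroup.det g) : ℝ)| ≤ L := by
    intro g hg
    obtain ⟨b, hprod, hroot, y, hyY, rfl⟩ := hdec g hg
    have hdet : (IdeleClassGroup.ideleNorm K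
        (Matrix.GeneralLinearGroup.det (posRealDiagonal n K b * y)) : ℝ) =
        (IdeleClassGroup.ideleNorm K (Matrix.GeneralLinearGroup.det y) : ℝ) := by
      change ((glAbsDet n K (posRealDiagonal n K b * y) : ℝ≥0) : ℝ) = ((glAbsDet n K y : ℝ≥0) : ℝ)
      rw [map_mul, glAbsDet_eq_one_of_mem_siegelCone ⟨b, hprod, hroot, rfl⟩, one_mul]
    have hdet' : ((adelicAbsDet n K (posRealDiagonal n K b * y)⁻¹ : ℝ≥0) : ℝ) =
        (IdeleClassGroup.ideleNorm K (Matrix.GeneralLinearGroup.det y) : ℝ)⁻¹ := by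
      rw [map_inv, NNReal.coe_inv, ← hdet]
      rfl
    refine ⟨?_, ?_, ?_⟩
    · rw [hdet]
      exact ((Real.le_norm_self _).trans (hD y hyY)).trans (le_max_left _ _)
    · rw [hdet']
      exact ((Real.le_norm_self _).trans (hA₀ y hyY)).trans (le_max_left _ _)
    · rw [hdet]
      have h := hL₀ y hyY
      rw [Real.norm_eq_abs] at h
      exact h.trans (le_max_left _ _)
  -- (2) the dominating function `H` and `J = ∫_S |ψ ψ'| H < ∞`
  set H : GL (Fin n) (AdeleRing (𝓞 K) K) → ℝ≥0∞ := fun g =>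
    ENNReal.ofReal (D₂ ^ 2) * (M₁ g + ENNReal.ofReal (cD * A) * M₂ g + ENNReal.ofReal (Vr * ‖Φ 0‖ / n)) +
      ENNReal.ofReal (2 * ‖R‖ * L) with hH
  have hHm : Measurable H := by
    have hM₁m : Measurable M₁ :=
      measurable_tsum_lintegral_enorm_smul_vecMul ν (continuous_of_mem_piSchwartzBruhat hΦ) _ continuous_id
    have hM₂m : Measurable M₂ :=
      measurable_tsum_lintegral_enorm_smul_vecMul ν
        (continuous_of_mem_piSchwartzBruhat (adelicPiFourier_mem_piSchwartzBruhat hΦ)) _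
        continuous_glTransposeInv
    exact ((((hM₁m.add (hM₂m.const_mul _)).add_const _).const_mul _).add_const _)
  set J : ℝ≥0∞ := ∫⁻ g in S, (‖ψ g * ψ' g‖ₑ : ℝ≥0∞) * H g ∂μG with hJ
  have hJfin : J < ⊤ := by
    -- `a b ≤ a² + b²` in `[0, ∞]` (also `Literature.Analysis.FluidPDE.ennreal_mul_le_sq_add_sq`, not imported)
    have hsq : ∀ a b : ℝ≥0∞, a * b ≤ a ^ 2 + b ^ 2 := fun a b => by
      rcases le_total a b with h | h
      · calc a * b ≤ b * b := mul_le_mul' h le_rfl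
          _ = b ^ 2 := (sq b).symm
          _ ≤ a ^ 2 + b ^ 2 := le_add_self
      · calc a * b ≤ a * a := mul_le_mul' le_rfl h
          _ = a ^ 2 := (sq a).symm
          _ ≤ a ^ 2 + b ^ 2 := le_self_add
    have hψm : Measurable fun g : GL (Fin n) (AdeleRing (𝓞 K) K) => (‖ψ g‖ₑ : ℝ≥0∞) ^ 2 * H g :=
      (hψc.measurable.enorm.pow_const 2).mul hHm
    have hfinψ := setLIntegral_siegel_normSq_mul_residualMajorant_lt_top μG ν μ hΦ hψc hφd hΩc hΩB ht
      hZc hZ (c₁ := ENNReal.ofReal (D₂ ^ 2)) (c₂ := ENNReal.ofReal (cD * A))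
      (c₃ := ENNReal.ofReal (Vr * ‖Φ 0‖ / n)) (c₄ := ENNReal.ofReal (2 * ‖R‖ * L))
      ENNReal.ofReal_ne_top ENNReal.ofReal_ne_top ENNReal.ofReal_ne_top ENNReal.ofReal_ne_top
    have hfinψ' := setLIntegral_siegel_normSq_mul_residualMajorant_lt_top μG ν μ hΦ hψ'c hφ'd hΩc hΩB ht
      hZc hZ (c₁ := ENNReal.ofReal (D₂ ^ 2)) (c₂ := ENNReal.ofReal (cD * A))
      (c₃ := ENNReal.ofReal (Vr * ‖Φ 0‖ / n)) (c₄ := ENNReal.ofReal (2 * ‖R‖ * L))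
      ENNReal.ofReal_ne_top ENNReal.ofReal_ne_top ENNReal.ofReal_ne_top ENNReal.ofReal_ne_top
    calc J ≤ ∫⁻ g in S, (‖ψ g‖ₑ : ℝ≥0∞) ^ 2 * H g + (‖ψ' g‖ₑ : ℝ≥0∞) ^ 2 * H g ∂μG := by
          refine lintegral_mono fun g => ?_
          rw [← add_mul, enorm_mul]
          exact mul_le_mul' (hsq _ _) le_rfl
      _ = (∫⁻ g in S, (‖ψ g‖ₑ : ℝ≥0∞) ^ 2 * H g ∂μG) + ∫⁻ g in S, (‖ψ' g‖ₑ : ℝ≥0∞) ^ 2 * H g ∂μG :=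
          lintegral_add_left hψm _
      _ < ⊤ := ENNReal.add_lt_top.2 ⟨hfinψ, hfinψ'⟩
  -- (3) integrability of `P = φ φ'`
  obtain ⟨Cψ, hCψ0, hψb⟩ := exists_norm_le_on_siegelSet hψc hφd hΩc hΩB ht hZc hZ
  obtain ⟨Cψ', hCψ'0, hψ'b⟩ := exists_norm_le_on_siegelSet hψ'c hφ'd hΩc hΩB ht hZc hZ
  have hPm : AEStronglyMeasurable P μ' := (hφc.mul hφ'c).aestronglyMeasurable
  have hPint : Integrable P μ' := by
    refine ⟨hPm, ?_⟩
    change ∫⁻ x, ‖P x‖ₑ ∂μ' < ⊤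
    calc ∫⁻ x, ‖P x‖ₑ ∂μ'
        ≤ c * ∫⁻ g in S, ‖P ((AdelicGroupData.gl n K).toAutomorphicQuotient g⁻¹)‖ₑ ∂μG := hle _
      _ ≤ c * ∫⁻ _g in S, ENNReal.ofReal (Cψ * Cψ') ∂μG := by
          refine mul_le_mul' le_rfl (setLIntegral_mono' hSm fun g hg => ?_)
          rw [hPmk, ← ofReal_norm, norm_mul]
          exact ENNReal.ofReal_le_ofReal (mul_le_mul (hψb g hg) (hψ'b g hg) (norm_nonneg _) hCψ0)
      _ = c * (ENNReal.ofReal (Cψ * Cψ') * μG S) := by rw [setLIntegral_const]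
      _ < ⊤ := ENNReal.mul_lt_top hc.lt_top (ENNReal.mul_lt_top ENNReal.ofReal_lt_top hSfin)
  -- (4) the key estimate near `s = 1`
  set δ : ℝ := 1 / (L + 1) with hδ
  have hδpos : 0 < δ := by rw [hδ]; positivity
  have hδ1 : δ ≤ 1 := by
    rw [hδ, div_le_one (by positivity)]
    linarith
  have hkey : ∀ s : ℂ, 1 < s.re → ‖s - 1‖ < δ →
      ‖(s - 1) * rankinSelbergIntegral μ' ν Φ s φ φ' - R * ∫ x, P x ∂μ'‖ ≤ ‖s - 1‖ * (c * J).toReal := by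
    intro s hs1 hsδ
    have hs2 : s.re ≤ 2 := by
      have h := Complex.abs_re_le_norm (s - 1)
      rw [Complex.sub_re, Complex.one_re] at h
      have h' : ‖s - 1‖ ≤ 1 := hsδ.le.trans hδ1
      linarith [le_abs_self (s.re - 1)]
    have hsL : ‖s - 1‖ * L ≤ 1 := by
      calc ‖s - 1‖ * L ≤ δ * L := mul_le_mul_of_nonneg_right hsδ.le hL0
        _ ≤ δ * (L + 1) := mul_le_mul_of_nonneg_left (by linarith) hδpos.le
        _ = 1 := by rw [hδ]; field_simp
    -- pointwise on `S`
    have hpt : ∀ g ∈ S, (‖P ((AdelicGroupData.gl n K).toAutomorphicQuotient g⁻¹) *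
        ((s - 1) * mirabolicEisensteinQuot ν Φ s ((AdelicGroupData.gl n K).toAutomorphicQuotient g⁻¹) - R)‖ₑ :
          ℝ≥0∞) ≤ ‖s - 1‖ₑ * ((‖ψ g * ψ' g‖ₑ : ℝ≥0∞) * H g) := by
      intro g hg
      obtain ⟨hgD, hgA, hgL⟩ := hdetS g hg
      rw [enorm_mul, hPmk, hEg, mul_left_comm]
      exact mul_le_mul' le_rfl (enorm_sub_one_mul_mirabolicEisenstein_sub_residue_le ν hn μ hΦ hD₂1 hL0
        hgD hgA hgL hs1 hs2 hsL)
    -- the lintegral over the quotient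
    have hlin : ∫⁻ x, (‖P x * ((s - 1) * mirabolicEisensteinQuot ν Φ s x - R)‖ₑ : ℝ≥0∞) ∂μ' ≤
        ‖s - 1‖ₑ * (c * J) := by
      calc ∫⁻ x, (‖P x * ((s - 1) * mirabolicEisensteinQuot ν Φ s x - R)‖ₑ : ℝ≥0∞) ∂μ'
          ≤ c * ∫⁻ g in S, (‖P ((AdelicGroupData.gl n K).toAutomorphicQuotient g⁻¹) *
              ((s - 1) * mirabolicEisensteinQuot ν Φ s ((AdelicGroupData.gl n K).toAutomorphicQuotient g⁻¹) -
                R)‖ₑ : ℝ≥0∞) ∂μG := hle _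
        _ ≤ c * ∫⁻ g in S, ‖s - 1‖ₑ * ((‖ψ g * ψ' g‖ₑ : ℝ≥0∞) * H g) ∂μG :=
            mul_le_mul' le_rfl (setLIntegral_mono' hSm hpt)
        _ = ‖s - 1‖ₑ * (c * J) := by
            rw [lintegral_const_mul' _ _ enorm_ne_top]
            ring
    -- integrability of `P ((s - 1) E_X - R)` and of `P (s - 1) E_X`
    have hEc : Continuous (mirabolicEisensteinQuot (K := K) ν Φ s) :=
      continuous_mirabolicEisensteinQuot_of_mem_piSchwartzBruhat K ν hΦ hs1
    have hQint : Integrable (fun x => P x * ((s - 1) * mirabolicEisensteinQuot ν Φ s x - R)) μ' :=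
      ⟨((hφc.mul hφ'c).mul ((continuous_const.mul hEc).sub continuous_const)).aestronglyMeasurable,
        lt_of_le_of_lt hlin (ENNReal.mul_lt_top enorm_lt_top (ENNReal.mul_lt_top hc.lt_top hJfin))⟩
    have hI1 : Integrable (fun x => (s - 1) * (φ x * φ' x * mirabolicEisensteinQuot ν Φ s x)) μ' :=
      (hQint.add (hPint.const_mul R)).congr (Eventually.of_forall fun x => by
        simp only [hP, Pi.add_apply]
        ring)
    have hI2 : Integrable (fun x => R * P x) μ' := hPint.const_mul R
    have hident : (s - 1) * rankinSelbergIntegral μ' ν Φ s φ φ' - R * ∫ x, P x ∂μ' =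
        ∫ x, P x * ((s - 1) * mirabolicEisensteinQuot ν Φ s x - R) ∂μ' := by
      unfold rankinSelbergIntegral
      rw [← integral_const_mul, ← integral_const_mul, ← integral_sub hI1 hI2]
      refine integral_congr_ae (Eventually.of_forall fun x => ?_)
      simp only [hP]
      ring
    rw [hident]
    have hne : ‖s - 1‖ₑ * (c * J) ≠ ⊤ :=
      ENNReal.mul_ne_top enorm_ne_top (ENNReal.mul_ne_top hc hJfin.ne)
    calc ‖∫ x, P x * ((s - 1) * mirabolicEisensteinQuot ν Φ s x - R) ∂μ'‖
        = (‖∫ x, P x * ((s - 1) * mirabolicEisensteinQuot ν Φ s x - R) ∂μ'‖ₑ).toReal :=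
          (toReal_enorm _).symm
      _ ≤ (‖s - 1‖ₑ * (c * J)).toReal :=
          ENNReal.toReal_mono hne ((enorm_integral_le_lintegral_enorm _).trans hlin)
      _ = ‖s - 1‖ * (c * J).toReal := by rw [ENNReal.toReal_mul, toReal_enorm]
  -- (5) conclusion
  have hlim : Tendsto (fun s : ℂ => ‖s - 1‖ * (c * J).toReal) (𝓝[{s : ℂ | 1 < s.re}] 1) (𝓝 0) := by
    have h : Tendsto (fun s : ℂ => ‖s - 1‖ * (c * J).toReal) (𝓝 1)
        (𝓝 (‖(1 : ℂ) - 1‖ * (c * J).toReal)) :=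
      ((continuous_id.sub continuous_const).norm.mul continuous_const).tendsto 1
    rw [sub_self, norm_zero, zero_mul] at h
    exact h.mono_left nhdsWithin_le_nhds
  refine tendsto_iff_norm_sub_tendsto_zero.2
    (squeeze_zero' (Eventually.of_forall fun s => norm_nonneg _) ?_ hlim)
  have hmem : {s : ℂ | 1 < s.re} ∩ Metric.ball (1 : ℂ) δ ∈ 𝓝[{s : ℂ | 1 < s.re}] 1 :=
    inter_mem_nhdsWithin _ (Metric.ball_mem_nhds _ hδpos)
  refine Filter.mem_of_superset hmem fun s hs => ?_
  obtain ⟨hs1, hsδ⟩ := hs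
  rw [Metric.mem_ball, dist_eq_norm] at hsδ
  exact hkey s hs1 hsδ

end Residue

end Literature.NumberTheory.Automorphic
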